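import Literature.Analysis.FunctionSpaces.PotentialDynamics
import Literature.MathematicalPhysics.KineticTheory.NewtonianFlowLiouville
import Literature.Analysis.ODE.LipschitzFlow
import Mathlib.MeasureTheory.Measure.Regular
import Mathlib.MeasureTheory.Constructions.BorelSpace.Metrizable
import Mathlib.MeasureTheory.Function.Floor
import Mathlib.Analysis.SpecialFunctions.SmoothTransition
import Mathlib.Analysis.InnerProductSpace.Calculus
import Mathlib.Analysis.Calculus.ContDiff.RCLike
import HarnessLib

/-!
# The Hamiltonian flow of `N` particles in `ℝ^d` with a short-range repulsive potential exists
(`PotentialFlow.nonempty_euclidean_holds`)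

`Literature/Analysis/FunctionSpaces/` — the PROOFS companion of `PotentialDynamics.lean`, discharging
the named fact `Literature.Analysis.FunctionSpaces.PotentialFlow.nonempty_euclidean`: for a short-range
repulsive potential `Φ` (`ShortRangePotential d`: radial profile `φ`, `C²`, nonincreasing and `≥ 0` on
`(0, ∞)`, `φ = 0` on `[1, ∞)`, `φ → +∞` at `0⁺`), every `ε > 0`, every `N` and `d ≠ ∅`, the `N`-body
system `ẋ_i = v_i`, `v̇_i = -∑_{j≠i} ∇Φ_ε(x_i - x_j)` (Gallagher–Saint-Raymond–Texier, (1.2.2)) has a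
`PotentialFlow (Euclidean.geometry d) Φ ε N`: an a.e.-defined measurable, Lebesgue-measure-preserving
one-parameter group of genuine Hamiltonian trajectories on a measurable, invariant, conull good set
avoiding coincidences. The source treats this as standard ("Contrary to the potential case …, it is
not obvious [for hard spheres] that (2.1.1) defines a global dynamics … this is not a simple
consequence of the Cauchy-Lipschitz theorem", Ch. 2 §2.1 of the 2012 text; the Hamiltonian flow and
Liouville's equation (4.0.1) on `Ω_N := {Z_N | ∀ i ≠ j, x_i ≠ x_j}`, Ch. 4), i.e. Cauchy–Lipschitz +
conservation of energy + Liouville's theorem (Arnold, §16 Thm 1). Everything below is PROVED; no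
named fact is introduced.

## The proof formalised here

* **A. Newtonian systems with bounded Lipschitz force** (`NewtonSystem`, general real normed `Q`):
  the global flow `NewtonSystem.flow` of `X_F(x, v) = (v, F x)` on `Q × Q` (the tree's
  `Literature.Analysis.ODE.lipschitzFlow`), group law, Grönwall continuity in the datum, the
  volume-preserving shears `(x, v) ↦ (x + hv, v)`, `(x, v) ↦ (x, v + hF x)` (Fubini,
  `MeasurePreserving.skew_product`), local error `O(h²)` and global error `O(1/k)` of the symplectic
  Euler scheme, pointwise convergence, Fatou `vol(Ψ_t⁻¹ U) ≤ vol U` on open sets, outer regularity,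
  `Ψ_{-t} = Ψ_t⁻¹` ⇒ **Liouville** `NewtonSystem.measurePreserving_flow`. This is a PORT to a general
  phase space `Q × Q` (here `Q = (ℝ^d)^N` with the sup norm) of
  `Literature.MathematicalPhysics.KineticTheory.NewtonianFlow` / `NewtonianFlowLiouville` (written for
  `HeatConduction.PhaseSpace n = (Fin n → ℝ)²`), whose `le_of_error_recursion` is reused; Mathlib has
  no differentiability of flows in the datum, whence no Jacobian proof.
* **B. Regularisation below an energy floor** (`ShortRangePotential.regProfile`, `regPot`): for
  `0 < δ ≤ 1`, `φ_δ := χ_δ φ + (1 - χ_δ) φ(δ/2)` with the smooth step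
  `χ_δ(r) = Real.smoothTransition (2r/δ - 1)` equals `φ` on `[δ, ∞)`, is constant on `(-∞, δ/2]`,
  is `C²` on `ℝ`, and `φ(δ) ≤ φ_δ` on `(-∞, δ]`; the pair potential `Φ_{δ,ε}(y) = φ_δ(|y|/ε)` is `C²`
  on `ℝ^d` (constant near `0`), its gradient is `C¹` with compact support, hence bounded and globally
  Lipschitz, odd, and equal to `∇Φ_ε` where `|y| > εδ`.
* **C. The regularised `N`-body system** (`PotentialFlow.NonemptyEuclidean.pairForce/pairEnergy`):
  Lipschitz/boundedness of `x ↦ (-∑_{j≠i} g(x_i - x_j))_i`, the pair energy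
  `½∑|v_i|² + ½∑_i∑_{j≠i} P(x_i - x_j)`, and its conservation along integral curves of `X_F`
  (`hasDerivAt_pairEnergy`, from the chain rule and `∑_i∑_j ⟪g(x_i-x_j), v_i-v_j⟫ = 2∑_i∑_j ⟪g, v_i⟫`
  for odd `g`).
* **D. Levels and gluing.** For each `n : ℕ` pick `δ_n ∈ (0, 1]` with `φ(δ_n) > n + 1` (`φ → ∞` at
  `0⁺`); `levelFlow n` is the global flow of the `δ_n`-regularised system, Lebesgue-measure preserving
  by A. A non-coincident datum of true energy `H < n + 1 < φ(δ_n)` has all separations `> εδ_n`;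
  conservation of the regularised energy keeps them `> εδ_n` for all times, so the level-`n` orbit is
  a TRUE Hamiltonian trajectory (`levelForce_eq_force`), stays non-coincident and keeps its level
  `⌊H⌋₊ = n` (`level_dynamics`, `good_dynamics`). The flow `flowMap t z := levelMap ⌊H z⌋₊ t z`
  (transported to `Config N d ℝ^d` by the measure-preserving `MeasurableEquiv.arrowProdEquivProdArrow`)
  is measurable (countably many continuous pieces), a group on the good set `noCoincidence`, whose
  complement is a finite union of proper hyperplanes, hence null (`Measure.addHaar_submodule`; this is
  where `d ≠ ∅` enters), and preserves volume: on each invariant piece `good ∩ {level = n}` it is the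
  measure-preserving `levelMap n t`, and the pieces partition a conull set (`measurePreserving_flowMap`).

## References

* I. Gallagher, L. Saint-Raymond, B. Texier, *From Newton to Boltzmann: the case of short-range
  potentials*, hal-00719892 / arXiv:1208.5753 v1 (2012) (held: `paper:galaxy-pdf-710104080`): Ch. 1
  §1.2, (1.2.2) (the Hamiltonian system); Ch. 2 §2.1, p. 9 (global dynamics for potentials = Cauchy–
  Lipschitz); Ch. 4, p. 21, (4.0.1) and `Ω_N` (the flow on non-coincident configurations). EMS book
  version (2013) = bib key `GST2013` of the main file. [GallagherSaintraymondTexier2012]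
* V. I. Arnold, *Mathematical Methods of Classical Mechanics*, 2nd ed. (1989), §16 "Liouville's
  theorem", Thm 1 "The phase flow preserves volume" (held copy PDF p. 65). [Arnold1989]

## Design notes / not here

* The flow is NOT obtained from local Picard–Lindelöf patches of the singular field: regularising the
  profile below the energy floor gives globally Lipschitz fields, for which the tree already has global
  flows, and Liouville is inherited level by level. Outside the good set the flow map is the (junk)
  regularised dynamics, as `PotentialFlow` allows.
* Not here: the torus version `PotentialFlow.nonempty_torus` (needs the minimal-image separation,
  smooth only for `ε < 1/2`), the uniqueness facts `eqOn_of_mem_good_*` and the conservation facts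
  `hamiltonianEnergy_flow_*` of the main file (statements about ALL potential flows, not about this
  construction).
-/

noncomputable section

open MeasureTheory Filter Topology Set Metric
open scoped NNReal ENNReal InnerProductSpace

namespace Literature.Analysis.FunctionSpaces

/-! ## A. Newtonian systems `ẋ = v`, `v̇ = F(x)` on `Q × Q` with bounded Lipschitz force:
global flow and Liouville's theorem

The `Q`-general version of `Literature.MathematicalPhysics.KineticTheory.NewtonianFlow` /
`NewtonianFlowLiouville` (written for `Q = ℝ^n`, `PhaseSpace n`); same proofs, with the flow taken to
be `Literature.Analysis.ODE.lipschitzFlow` (so no joint-continuity clause is needed: outer regularity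
replaces the π-system argument, as in `NewtonianFlowLocal`). -/

namespace NewtonSystem

section Field

variable {Q : Type*}

/-- Newton's vector field `X_F(x, v) = (v, F x)` on `Q × Q` (unit masses). [folklore] -/
def vectorField (F : Q → Q) (z : Q × Q) : Q × Q := (z.2, F z.1)

/-- First component of `X_F`. [folklore] -/
@[simp] theorem vectorField_fst (F : Q → Q) (z : Q × Q) : (vectorField F z).1 = z.2 := rfl

/-- Second component of `X_F`. [folklore] -/
@[simp] theorem vectorField_snd (F : Q → Q) (z : Q × Q) : (vectorField F z).2 = F z.1 := rfl

/-- `X_F` is globally Lipschitz when `F` is. [folklore] -/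
theorem lipschitzWith_vectorField [NormedAddCommGroup Q] {F : Q → Q} {K : ℝ≥0}
    (hF : LipschitzWith K F) :
    LipschitzWith (max 1 K) (vectorField F) := by
  have h1 : LipschitzWith 1 (fun z : Q × Q => z.2) := LipschitzWith.prod_snd
  have h2 : LipschitzWith K (fun z : Q × Q => F z.1) := by
    have h := hF.comp (LipschitzWith.prod_fst (α := Q) (β := Q))
    rw [mul_one] at h
    exact h
  change LipschitzWith (max 1 K) (fun z : Q × Q => ((z.2, F z.1) : Q × Q))
  exact h1.prodMk h2

end Field

variable {Q : Type*} [NormedAddCommGroup Q] [NormedSpace ℝ Q] [CompleteSpace Q] {F : Q → Q}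
  {K : ℝ≥0}

/-- The **global flow** `Ψ_t` of `ẋ = v`, `v̇ = F(x)` for a globally Lipschitz force (time first,
then the phase point): the Lipschitz flow `Literature.Analysis.ODE.lipschitzFlow` of `X_F`.
[folklore] -/
def flow (hF : LipschitzWith K F) (t : ℝ) (z : Q × Q) : Q × Q :=
  Literature.Analysis.ODE.lipschitzFlow (lipschitzWith_vectorField hF) z t

/-- `Ψ_0 = id`. [folklore] -/
@[simp] theorem flow_zero (hF : LipschitzWith K F) (z : Q × Q) : flow hF 0 z = z :=
  Literature.Analysis.ODE.lipschitzFlow_zero _ z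

/-- Flow curves are integral curves of `X_F`. [folklore] -/
theorem hasDerivAt_flow (hF : LipschitzWith K F) (z : Q × Q) (t : ℝ) :
    HasDerivAt (fun s => flow hF s z) (vectorField F (flow hF t z)) t :=
  Literature.Analysis.ODE.hasDerivAt_lipschitzFlow _ z t

/-- **Group law** `Ψ_{s+t} = Ψ_t ∘ Ψ_s`. [folklore] -/
theorem flow_add (hF : LipschitzWith K F) (s t : ℝ) (z : Q × Q) :
    flow hF (s + t) z = flow hF t (flow hF s z) :=
  Literature.Analysis.ODE.lipschitzFlow_add _ z s t

/-- `Ψ_{-t} ∘ Ψ_t = id`. [folklore] -/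
theorem flow_neg_flow (hF : LipschitzWith K F) (t : ℝ) (z : Q × Q) :
    flow hF (-t) (flow hF t z) = z := by
  rw [← flow_add, add_neg_cancel, flow_zero]

/-- `Ψ_t ∘ Ψ_{-t} = id`. [folklore] -/
theorem flow_flow_neg (hF : LipschitzWith K F) (t : ℝ) (z : Q × Q) :
    flow hF t (flow hF (-t) z) = z := by
  rw [← flow_add, neg_add_cancel, flow_zero]

/-- **Uniqueness**: a global integral curve of `X_F` is a flow curve. [folklore] -/
theorem eq_flow_of_hasDerivAt (hF : LipschitzWith K F) {γ : ℝ → Q × Q}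
    (hγ : ∀ t, HasDerivAt γ (vectorField F (γ t)) t) (t : ℝ) : γ t = flow hF t (γ 0) := by
  have ht : t ∈ Ioo (-(|t| + 1)) (|t| + 1) := by
    constructor <;> cases abs_cases t <;> linarith
  have h0 : (0 : ℝ) ∈ Ioo (-(|t| + 1)) (|t| + 1) := by
    constructor <;> linarith [abs_nonneg t]
  exact Literature.Analysis.ODE.eqOn_lipschitzFlow (lipschitzWith_vectorField hF) h0
    (fun s _ => hγ s) ht

/-- Flow curves are continuous. [folklore] -/
theorem continuous_curve (hF : LipschitzWith K F) (z : Q × Q) : Continuous fun s => flow hF s z :=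
  continuous_iff_continuousAt.2 fun t => (hasDerivAt_flow hF z t).continuousAt

/-- The position component of a flow curve has derivative `v`. [folklore] -/
theorem hasDerivAt_fst (hF : LipschitzWith K F) (z : Q × Q) (t : ℝ) :
    HasDerivAt (fun s => (flow hF s z).1) ((flow hF t z).2) t :=
  ((ContinuousLinearMap.fst ℝ Q Q).hasFDerivAt).comp_hasDerivAt t (hasDerivAt_flow hF z t)

/-- The velocity component of a flow curve has derivative `F(x)`. [folklore] -/
theorem hasDerivAt_snd (hF : LipschitzWith K F) (z : Q × Q) (t : ℝ) :
    HasDerivAt (fun s => (flow hF s z).2) (F (flow hF t z).1) t :=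
  ((ContinuousLinearMap.snd ℝ Q Q).hasFDerivAt).comp_hasDerivAt t (hasDerivAt_flow hF z t)

/-- **Grönwall**: `‖Ψ_t z - Ψ_t z'‖ ≤ e^{max(1,K)|t|} ‖z - z'‖`. [folklore] -/
theorem dist_flow_le (hF : LipschitzWith K F) (t : ℝ) (z z' : Q × Q) :
    dist (flow hF t z) (flow hF t z') ≤ dist z z' * Real.exp ((max 1 K : ℝ≥0) * |t|) := by
  have hX := lipschitzWith_vectorField hF
  rcases le_or_gt 0 t with ht | ht
  · have h := dist_le_of_trajectories_ODE (v := fun _ => vectorField F) (K := max 1 K)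
      (f := fun s => flow hF s z) (g := fun s => flow hF s z') (a := 0) (b := t)
      (δ := dist z z')
      (fun _ => hX) (continuous_curve hF z).continuousOn
      (fun s _ => (hasDerivAt_flow hF z s).hasDerivWithinAt)
      (continuous_curve hF z').continuousOn
      (fun s _ => (hasDerivAt_flow hF z' s).hasDerivWithinAt)
      (by rw [flow_zero, flow_zero]) t ⟨ht, le_rfl⟩
    rw [abs_of_nonneg ht]
    simpa using h
  · have hrev : ∀ w : Q × Q, ∀ s, HasDerivAt (fun s => flow hF (-s) w)
        (-(vectorField F (flow hF (-s) w))) s := fun w s => by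
      have := (hasDerivAt_flow hF w (-s)).scomp s (hasDerivAt_neg s)
      simpa [Function.comp_def] using this
    have h := dist_le_of_trajectories_ODE (v := fun _ w => -(vectorField F w)) (K := max 1 K)
      (f := fun s => flow hF (-s) z) (g := fun s => flow hF (-s) z') (a := 0) (b := -t)
      (δ := dist z z')
      (fun _ => hX.neg)
      ((continuous_curve hF z).comp continuous_neg).continuousOn
      (fun s _ => (hrev z s).hasDerivWithinAt)
      ((continuous_curve hF z').comp continuous_neg).continuousOn
      (fun s _ => (hrev z' s).hasDerivWithinAt)
      (by simp only [neg_zero, flow_zero]; exact le_rfl) (-t) ⟨by linarith, le_rfl⟩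
    simp only [neg_neg, sub_zero] at h
    rwa [abs_of_neg ht]

/-- Each flow map `Ψ_t` is (Lipschitz) continuous. [folklore] -/
theorem continuous_flow (hF : LipschitzWith K F) (t : ℝ) : Continuous (flow hF t) :=
  (LipschitzWith.of_dist_le' fun z z' =>
    (dist_flow_le hF t z z').trans_eq (mul_comm _ _)).continuous

/-- **A priori bound on velocities**: `‖v(s) - v(0)‖ ≤ M|s|` when `‖F‖ ≤ M`. [folklore] -/
theorem norm_snd_sub_le (hF : LipschitzWith K F) {M : ℝ} (hM : ∀ q, ‖F q‖ ≤ M) (s : ℝ)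
    (z : Q × Q) : ‖(flow hF s z).2 - z.2‖ ≤ M * |s| := by
  have h := Convex.norm_image_sub_le_of_norm_hasDerivWithin_le (f := fun r => (flow hF r z).2)
    (f' := fun r => F (flow hF r z).1) (s := uIcc 0 s) (C := M)
    (fun r _ => (hasDerivAt_snd hF z r).hasDerivWithinAt) (fun r _ => hM _) (convex_uIcc 0 s)
    left_mem_uIcc right_mem_uIcc
  simpa using h

/-- **A priori bound on positions**: `‖x(s) - x(0) - s v(0)‖ ≤ M s²` when `‖F‖ ≤ M`. [folklore] -/
theorem norm_fst_sub_le (hF : LipschitzWith K F) {M : ℝ} (hM : ∀ q, ‖F q‖ ≤ M) (s : ℝ)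
    (z : Q × Q) : ‖(flow hF s z).1 - z.1 - s • z.2‖ ≤ M * s ^ 2 := by
  have hM0 : 0 ≤ M := (norm_nonneg _).trans (hM 0)
  have hd : ∀ r, HasDerivAt (fun r => (flow hF r z).1 - r • z.2) ((flow hF r z).2 - z.2) r :=
    fun r => by
    have := (hasDerivAt_fst hF z r).sub ((hasDerivAt_id r).smul_const z.2)
    simp only [id, one_smul] at this
    exact this
  have h := Convex.norm_image_sub_le_of_norm_hasDerivWithin_le
    (f := fun r => (flow hF r z).1 - r • z.2)
    (f' := fun r => (flow hF r z).2 - z.2) (s := uIcc 0 s) (C := M * |s|)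
    (fun r _ => (hd r).hasDerivWithinAt)
    (fun r hr => by
      refine (norm_snd_sub_le hF hM r z).trans ?_
      refine mul_le_mul_of_nonneg_left ?_ hM0
      rcases le_total 0 s with hs | hs
      · rw [uIcc_of_le hs] at hr
        rw [abs_of_nonneg hr.1, abs_of_nonneg hs]; exact hr.2
      · rw [uIcc_of_ge hs] at hr
        rw [abs_of_nonpos hr.2, abs_of_nonpos hs]; linarith [hr.1])
    (convex_uIcc 0 s) left_mem_uIcc right_mem_uIcc
  have h' : ‖(flow hF s z).1 - s • z.2 - z.1‖ ≤ M * |s| * |s| := by simpa using h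
  rw [sub_right_comm]
  calc ‖(flow hF s z).1 - s • z.2 - z.1‖ ≤ M * |s| * |s| := h'
    _ = M * s ^ 2 := by rw [mul_assoc, ← sq, sq_abs]

/-! ### The symplectic Euler scheme: shears -/

omit [CompleteSpace Q] in
/-- The drift (free streaming) map `D_h(x, v) = (x + h v, v)`. [folklore] -/
def drift (h : ℝ) (z : Q × Q) : Q × Q := (z.1 + h • z.2, z.2)

omit [CompleteSpace Q] in
/-- The kick map `K_h(x, v) = (x, v + h F(x))`. [folklore] -/
def kick (F : Q → Q) (h : ℝ) (z : Q × Q) : Q × Q := (z.1, z.2 + h • F z.1)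

omit [CompleteSpace Q] in
/-- One step of the symplectic Euler scheme, `S_h = K_h ∘ D_h`. [folklore] -/
def eulerStep (F : Q → Q) (h : ℝ) (z : Q × Q) : Q × Q := kick F h (drift h z)

omit [CompleteSpace Q] in
/-- `S_h(x, v) = (x + hv, v + hF(x + hv))`. [folklore] -/
theorem eulerStep_apply (F : Q → Q) (h : ℝ) (z : Q × Q) :
    eulerStep F h z = (z.1 + h • z.2, z.2 + h • F (z.1 + h • z.2)) := rfl

section Measure

variable [MeasureSpace Q] [BorelSpace Q] [SecondCountableTopology Q]
  [SigmaFinite (volume : Measure Q)] [(volume : Measure Q).IsAddRightInvariant]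

omit [CompleteSpace Q] in
/-- The drift is a shear over the velocities, hence preserves `volume` (Fubini and translation
invariance). [folklore] -/
theorem measurePreserving_drift (h : ℝ) :
    MeasurePreserving (drift (Q := Q) h) volume volume := by
  have hskew : MeasurePreserving
      (fun p : Q × Q => (p.1, p.2 + h • p.1))
      ((volume : Measure Q).prod volume) ((volume : Measure Q).prod volume) :=
    (MeasurePreserving.id _).skew_product (g := fun p q => q + h • p)
      (measurable_snd.add (measurable_fst.const_smul h))
      (ae_of_all _ fun p => (measurePreserving_add_right volume (h • p)).map_eq)
  have e : (drift (Q := Q) h) = Prod.swap ∘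
      (fun p : Q × Q => (p.1, p.2 + h • p.1)) ∘ Prod.swap := by
    funext z; rfl
  rw [show (volume : Measure (Q × Q)) = (volume : Measure Q).prod volume from rfl, e]
  exact Measure.measurePreserving_swap.comp (hskew.comp Measure.measurePreserving_swap)

omit [CompleteSpace Q] in
/-- The kick is a shear over the positions, hence preserves `volume`. [folklore] -/
theorem measurePreserving_kick {F : Q → Q} (hF : Measurable F) (h : ℝ) :
    MeasurePreserving (kick (Q := Q) F h) volume volume := by
  rw [show (volume : Measure (Q × Q)) = (volume : Measure Q).prod volume from rfl]
  exact (MeasurePreserving.id _).skew_product (g := fun q p => p + h • F q)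
    (measurable_snd.add ((hF.comp measurable_fst).const_smul h))
    (ae_of_all _ fun q => (measurePreserving_add_right volume (h • F q)).map_eq)

omit [CompleteSpace Q] in
/-- The symplectic Euler step preserves `volume`. [folklore] -/
theorem measurePreserving_eulerStep {F : Q → Q} (hF : Measurable F) (h : ℝ) :
    MeasurePreserving (eulerStep (Q := Q) F h) volume volume :=
  (measurePreserving_kick hF h).comp (measurePreserving_drift h)

end Measure

omit [CompleteSpace Q] in
/-- Continuity of the Euler step. [folklore] -/
theorem continuous_eulerStep {F : Q → Q} (hF : Continuous F) (h : ℝ) :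
    Continuous (eulerStep (Q := Q) F h) := by
  unfold eulerStep kick drift
  fun_prop

omit [CompleteSpace Q] in
/-- Lipschitz bound for the Euler step: `Lip(S_h) ≤ (1 + |h|K)(1 + |h|)`. [folklore] -/
theorem dist_eulerStep_le {F : Q → Q} {K : ℝ≥0} (hF : LipschitzWith K F)
    (h : ℝ) (z w : Q × Q) :
    ‖eulerStep F h z - eulerStep F h w‖ ≤ (1 + |h| * K) * (1 + |h|) * ‖z - w‖ := by
  have hq : ‖z.1 - w.1‖ ≤ ‖z - w‖ := norm_fst_le (z - w)
  have hp : ‖z.2 - w.2‖ ≤ ‖z - w‖ := norm_snd_le (z - w)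
  have hd : ‖(z.1 + h • z.2) - (w.1 + h • w.2)‖ ≤ (1 + |h|) * ‖z - w‖ := by
    calc ‖(z.1 + h • z.2) - (w.1 + h • w.2)‖ = ‖(z.1 - w.1) + h • (z.2 - w.2)‖ := by
          congr 1; rw [smul_sub]; abel
      _ ≤ ‖z.1 - w.1‖ + ‖h • (z.2 - w.2)‖ := norm_add_le _ _
      _ ≤ ‖z - w‖ + |h| * ‖z - w‖ := by
          rw [norm_smul, Real.norm_eq_abs]; gcongr
      _ = (1 + |h|) * ‖z - w‖ := by ring
  have hK : ‖F (z.1 + h • z.2) - F (w.1 + h • w.2)‖ ≤ K * ((1 + |h|) * ‖z - w‖) :=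
    (hF.norm_sub_le _ _).trans (mul_le_mul_of_nonneg_left hd K.2)
  rw [eulerStep_apply, eulerStep_apply, Prod.norm_def]
  refine max_le ?_ ?_
  · refine hd.trans ?_
    have : 0 ≤ |h| * K * ((1 + |h|) * ‖z - w‖) := by positivity
    nlinarith
  · calc ‖z.2 + h • F (z.1 + h • z.2) - (w.2 + h • F (w.1 + h • w.2))‖
        = ‖(z.2 - w.2) + h • (F (z.1 + h • z.2) - F (w.1 + h • w.2))‖ := by
          congr 1; rw [smul_sub]; abel
      _ ≤ ‖z.2 - w.2‖ + ‖h • (F (z.1 + h • z.2) - F (w.1 + h • w.2))‖ := norm_add_le _ _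
      _ ≤ ‖z - w‖ + |h| * (K * ((1 + |h|) * ‖z - w‖)) := by
          rw [norm_smul, Real.norm_eq_abs]; gcongr
      _ ≤ (1 + |h| * K) * (1 + |h|) * ‖z - w‖ := by
          have : 0 ≤ |h| * ‖z - w‖ := by positivity
          nlinarith

/-! ### Convergence of the scheme and Liouville's theorem -/

/-- **Local error of the symplectic Euler step** along the flow:
`‖S_h(w) - Ψ_h(w)‖ ≤ (M + KM|h| + K‖v‖) h²` for `F` `K`-Lipschitz with `‖F‖ ≤ M`. [folklore] -/
theorem norm_eulerStep_sub_le (hF : LipschitzWith K F)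
    {M : ℝ} (hM : ∀ q, ‖F q‖ ≤ M) (h : ℝ) (w : Q × Q) :
    ‖eulerStep F h w - flow hF h w‖ ≤ (M + K * M * |h| + K * ‖w.2‖) * h ^ 2 := by
  have hM0 : 0 ≤ M := (norm_nonneg _).trans (hM 0)
  have hK0 : (0 : ℝ) ≤ K := K.2
  -- position component
  have h1 : ‖(w.1 + h • w.2) - (flow hF h w).1‖ ≤ M * h ^ 2 := by
    rw [← norm_neg]
    have e : -((w.1 + h • w.2) - (flow hF h w).1) = (flow hF h w).1 - w.1 - h • w.2 := by abel
    rw [e]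
    exact norm_fst_sub_le hF hM h w
  -- velocity component
  set a := w.1 + h • w.2 with ha
  have hd : ∀ s, HasDerivAt (fun s => (flow hF s w).2 - s • F a) (F (flow hF s w).1 - F a) s :=
    fun s => by
    have := (hasDerivAt_snd hF w s).sub ((hasDerivAt_id s).smul_const (F a))
    simp only [id, one_smul] at this
    exact this
  have hbound : ∀ s ∈ uIcc 0 h, ‖F (flow hF s w).1 - F a‖ ≤ K * (M * h ^ 2 + |h| * ‖w.2‖) := by
    intro s hs
    have hs1 : |s| ≤ |h| := by simpa using Set.abs_sub_left_of_mem_uIcc hs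
    have hs2 : |h - s| ≤ |h| := by simpa using Set.abs_sub_right_of_mem_uIcc hs
    refine (hF.norm_sub_le _ _).trans (mul_le_mul_of_nonneg_left ?_ hK0)
    have e : (flow hF s w).1 - a = ((flow hF s w).1 - w.1 - s • w.2) + (s - h) • w.2 := by
      rw [ha, sub_smul]; abel
    rw [e]
    refine (norm_add_le _ _).trans (add_le_add ?_ ?_)
    · refine (norm_fst_sub_le hF hM s w).trans (mul_le_mul_of_nonneg_left ?_ hM0)
      rw [← sq_abs, ← sq_abs h]
      exact pow_le_pow_left₀ (abs_nonneg s) hs1 2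
    · rw [norm_smul, Real.norm_eq_abs, abs_sub_comm]
      exact mul_le_mul_of_nonneg_right hs2 (norm_nonneg _)
  have h2 := Convex.norm_image_sub_le_of_norm_hasDerivWithin_le
    (f := fun s => (flow hF s w).2 - s • F a)
    (f' := fun s => F (flow hF s w).1 - F a) (s := uIcc 0 h) (C := K * (M * h ^ 2 + |h| * ‖w.2‖))
    (fun s _ => (hd s).hasDerivWithinAt) hbound (convex_uIcc 0 h) left_mem_uIcc right_mem_uIcc
  simp only [zero_smul, sub_zero, flow_zero, Real.norm_eq_abs] at h2
  have h2' : ‖(w.2 + h • F a) - (flow hF h w).2‖ ≤ K * (M * h ^ 2 + |h| * ‖w.2‖) * |h| := by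
    rw [← norm_neg]
    have e : -((w.2 + h • F a) - (flow hF h w).2) = (flow hF h w).2 - h • F a - w.2 := by abel
    rw [e]; exact h2
  -- assemble
  rw [eulerStep_apply, Prod.norm_def, Prod.fst_sub, Prod.snd_sub]
  refine max_le (h1.trans ?_) (h2'.trans ?_)
  · have : 0 ≤ (K * M * |h| + K * ‖w.2‖) * h ^ 2 := by positivity
    nlinarith
  · have e : K * (M * h ^ 2 + |h| * ‖w.2‖) * |h| = (K * M * |h| + K * ‖w.2‖) * h ^ 2 := by
      have : |h| * |h| = h ^ 2 := by rw [← sq, sq_abs]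
      calc K * (M * h ^ 2 + |h| * ‖w.2‖) * |h|
          = K * M * |h| * h ^ 2 + K * ‖w.2‖ * (|h| * |h|) := by ring
        _ = (K * M * |h| + K * ‖w.2‖) * h ^ 2 := by rw [this]; ring
    rw [e]
    have : 0 ≤ M * h ^ 2 := by positivity
    nlinarith

/-- **Global error of the symplectic Euler scheme**: with `k` steps of size `h = t/k`,
`‖S_h^k(z) - Ψ_t(z)‖ ≤ C(z, t)/k`. [folklore] -/
theorem norm_iterate_eulerStep_sub_le (hF : LipschitzWith K F)
    {M : ℝ} (hM : ∀ q, ‖F q‖ ≤ M) (t : ℝ) (z : Q × Q) {k : ℕ} (hk : 0 < k) :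
    ‖(eulerStep F (t / k))^[k] z - flow hF t z‖ ≤
      ((M + K * M * |t| + K * (‖z.2‖ + M * |t|)) * t ^ 2 *
        Real.exp (|t| * K + |t| + t ^ 2 * K)) / k := by
  have hM0 : 0 ≤ M := (norm_nonneg _).trans (hM 0)
  have hK0 : (0 : ℝ) ≤ K := K.2
  have hk0 : (0 : ℝ) < k := by exact_mod_cast hk
  set h : ℝ := t / k with hh
  have hkh : (k : ℝ) * h = t := by rw [hh]; field_simp
  have habs : |h| ≤ |t| := by
    rw [hh, abs_div, Nat.abs_cast]
    exact div_le_self (abs_nonneg t) (by exact_mod_cast hk)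
  set L : ℝ := (1 + |h| * K) * (1 + |h|) with hL
  have hL1 : 1 ≤ L := by
    have h1 : 1 ≤ 1 + |h| * K := le_add_of_nonneg_right (by positivity)
    have h2 : 1 ≤ 1 + |h| := le_add_of_nonneg_right (abs_nonneg h)
    calc (1 : ℝ) = 1 * 1 := (mul_one 1).symm
      _ ≤ L := mul_le_mul h1 h2 zero_le_one (zero_le_one.trans h1)
  set B : ℝ := M + K * M * |t| + K * (‖z.2‖ + M * |t|) with hB
  have hB0 : 0 ≤ B := by positivity
  -- the error sequence
  set u : ℕ → ℝ := fun j => ‖(eulerStep F h)^[j] z - flow hF (j * h) z‖ with hu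
  have hu0 : u 0 = 0 := by simp [hu]
  have hrec : ∀ j < k, u (j + 1) ≤ L * u j + B * h ^ 2 := by
    intro j hj
    have hgroup : flow hF ((j + 1 : ℕ) * h) z = flow hF h (flow hF (j * h) z) := by
      rw [← flow_add]; congr 1; push_cast; ring
    have hloc := norm_eulerStep_sub_le hF hM h (flow hF (j * h) z)
    have hp : ‖(flow hF (j * h) z).2‖ ≤ ‖z.2‖ + M * |t| := by
      have h1 := norm_snd_sub_le hF hM (j * h) z
      have h2 : M * |(j : ℝ) * h| ≤ M * |t| := by
        refine mul_le_mul_of_nonneg_left ?_ hM0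
        rw [abs_mul, Nat.abs_cast, ← hkh, abs_mul, Nat.abs_cast]
        exact mul_le_mul_of_nonneg_right (by exact_mod_cast hj.le) (abs_nonneg h)
      calc ‖(flow hF (j * h) z).2‖ = ‖z.2 + ((flow hF (j * h) z).2 - z.2)‖ := by congr 1; abel
        _ ≤ ‖z.2‖ + ‖(flow hF (j * h) z).2 - z.2‖ := norm_add_le _ _
        _ ≤ ‖z.2‖ + M * |t| := by linarith
    have hcoef : M + K * M * |h| + K * ‖(flow hF (j * h) z).2‖ ≤ B := by
      rw [hB]; gcongr
    calc u (j + 1) = ‖eulerStep F h ((eulerStep F h)^[j] z) - flow hF h (flow hF (j * h) z)‖ := by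
          simp only [hu, Function.iterate_succ_apply', hgroup]
      _ ≤ ‖eulerStep F h ((eulerStep F h)^[j] z) - eulerStep F h (flow hF (j * h) z)‖ +
            ‖eulerStep F h (flow hF (j * h) z) - flow hF h (flow hF (j * h) z)‖ :=
          norm_sub_le_norm_sub_add_norm_sub _ _ _
      _ ≤ L * u j + (M + K * M * |h| + K * ‖(flow hF (j * h) z).2‖) * h ^ 2 :=
          add_le_add (dist_eulerStep_le hF h _ _) hloc
      _ ≤ L * u j + B * h ^ 2 := by gcongr
  have hfinal := Literature.MathematicalPhysics.KineticTheory.NewtonianFlow.le_of_error_recursion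
    hL1 (by positivity) hu0 hrec k le_rfl
  have hLk : L ^ k ≤ Real.exp (|t| * K + |t| + t ^ 2 * K) := by
    have h1 : L ≤ Real.exp (|h| * K + |h| + h ^ 2 * K) := by
      have e : L = 1 + (|h| * K + |h| + h ^ 2 * K) := by
        rw [hL]; have : |h| * |h| = h ^ 2 := by rw [← sq, sq_abs]
        calc (1 + |h| * K) * (1 + |h|) = 1 + (|h| * K + |h| + |h| * |h| * K) := by ring
          _ = 1 + (|h| * K + |h| + h ^ 2 * K) := by rw [this]
      rw [e, add_comm]; exact Real.add_one_le_exp _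
    calc L ^ k ≤ (Real.exp (|h| * K + |h| + h ^ 2 * K)) ^ k :=
          pow_le_pow_left₀ (zero_le_one.trans hL1) h1 k
      _ = Real.exp (k * (|h| * K + |h| + h ^ 2 * K)) := by rw [← Real.exp_nat_mul]
      _ ≤ Real.exp (|t| * K + |t| + t ^ 2 * K) := by
          refine Real.exp_le_exp.2 ?_
          have e1 : (k : ℝ) * |h| = |t| := by rw [← hkh, abs_mul, Nat.abs_cast]
          have e2 : (k : ℝ) * h ^ 2 ≤ t ^ 2 := by
            have : (k : ℝ) * h ^ 2 * 1 ≤ (k : ℝ) * h ^ 2 * k :=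
              mul_le_mul_of_nonneg_left (by exact_mod_cast hk) (by positivity)
            calc (k : ℝ) * h ^ 2 = (k : ℝ) * h ^ 2 * 1 := (mul_one _).symm
              _ ≤ (k : ℝ) * h ^ 2 * k := this
              _ = (k * h) ^ 2 := by ring
              _ = t ^ 2 := by rw [hkh]
          calc (k : ℝ) * (|h| * K + |h| + h ^ 2 * K)
              = (k * |h|) * K + k * |h| + (k * h ^ 2) * K := by ring
            _ ≤ |t| * K + |t| + t ^ 2 * K := by rw [e1]; gcongr
  have e3 : (k : ℝ) * (B * h ^ 2) = B * t ^ 2 / k := by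
    rw [hh]; field_simp
  calc ‖(eulerStep F (t / k))^[k] z - flow hF t z‖ = u k := by simp only [hu]; rw [hkh]
    _ ≤ k * (B * h ^ 2) * L ^ k := hfinal
    _ ≤ k * (B * h ^ 2) * Real.exp (|t| * K + |t| + t ^ 2 * K) := by gcongr
    _ = (B * t ^ 2 * Real.exp (|t| * K + |t| + t ^ 2 * K)) / k := by rw [e3]; ring

/-- **Convergence of the symplectic Euler scheme** to the flow, pointwise:
`S_{t/k}^k(z) → Ψ_t(z)` as `k → ∞`. [folklore] -/
theorem tendsto_iterate_eulerStep (hF : LipschitzWith K F)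
    {M : ℝ} (hM : ∀ q, ‖F q‖ ≤ M) (t : ℝ) (z : Q × Q) :
    Tendsto (fun k : ℕ => (eulerStep F (t / (k + 1 : ℕ)))^[k + 1] z) atTop
      (𝓝 (flow hF t z)) := by
  set C : ℝ := (M + K * M * |t| + K * (‖z.2‖ + M * |t|)) * t ^ 2 *
    Real.exp (|t| * K + |t| + t ^ 2 * K) with hC
  rw [tendsto_iff_norm_sub_tendsto_zero]
  have hb : ∀ k : ℕ, ‖(eulerStep F (t / (k + 1 : ℕ)))^[k + 1] z - flow hF t z‖ ≤
      C / ((k + 1 : ℕ) : ℝ) :=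
    fun k => norm_iterate_eulerStep_sub_le hF hM t z (Nat.succ_pos k)
  have hlim : Tendsto (fun k : ℕ => C / ((k + 1 : ℕ) : ℝ)) atTop (𝓝 0) :=
    (tendsto_const_div_atTop_nhds_zero_nat C).comp (tendsto_add_atTop_nat 1)
  exact squeeze_zero (fun k => norm_nonneg _) hb hlim

section Liouville

variable [MeasureSpace Q] [BorelSpace Q] [FiniteDimensional ℝ Q]
  [(volume : Measure Q).IsAddHaarMeasure]

/-- **Fatou step of Liouville's theorem**: the flow map does not increase the volume of open
sets, `vol(Ψ_t⁻¹ U) ≤ vol(U)` (the Euler iterates preserve volume and converge pointwise).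
[folklore] -/
theorem volume_preimage_le_of_isOpen (hF : LipschitzWith K F)
    {M : ℝ} (hM : ∀ q, ‖F q‖ ≤ M) (t : ℝ) {U : Set (Q × Q)}
    (hU : IsOpen U) : volume (flow hF t ⁻¹' U) ≤ volume U := by
  have hFc : Continuous F := hF.continuous
  set Ψ : ℕ → Q × Q → Q × Q := fun k => (eulerStep F (t / (k + 1 : ℕ)))^[k + 1]
    with hΨ
  have hΨc : ∀ k, Continuous (Ψ k) := fun k => (continuous_eulerStep hFc _).iterate _
  have hΨm : ∀ k, MeasurePreserving (Ψ k) volume volume := fun k =>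
    (measurePreserving_eulerStep hFc.measurable _).iterate _
  have hconv : ∀ z, Tendsto (fun k => Ψ k z) atTop (𝓝 (flow hF t z)) := fun z =>
    tendsto_iterate_eulerStep hF hM t z
  have hmU : MeasurableSet U := hU.measurableSet
  have hle : ∀ z, (flow hF t ⁻¹' U).indicator (1 : Q × Q → ℝ≥0∞) z ≤
      liminf (fun k => ((Ψ k) ⁻¹' U).indicator (1 : Q × Q → ℝ≥0∞) z) atTop := by
    intro z
    by_cases hz : flow hF t z ∈ U
    · have hev : ∀ᶠ k in atTop, Ψ k z ∈ U := (hconv z) (hU.mem_nhds hz)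
      refine le_liminf_of_le (f := (atTop : Filter ℕ))
        (u := fun k => ((Ψ k) ⁻¹' U).indicator (1 : Q × Q → ℝ≥0∞) z) (by isBoundedDefault) ?_
      filter_upwards [hev] with k hk
      have hk' : z ∈ (Ψ k) ⁻¹' U := hk
      have hz' : z ∈ flow hF t ⁻¹' U := hz
      rw [Set.indicator_of_mem hk', Set.indicator_of_mem hz']
    · have hz' : z ∉ flow hF t ⁻¹' U := hz
      rw [Set.indicator_of_notMem hz']
      exact bot_le
  calc volume (flow hF t ⁻¹' U)
      = ∫⁻ z, (flow hF t ⁻¹' U).indicator 1 z := (lintegral_indicator_one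
          (hmU.preimage (continuous_flow hF t).measurable)).symm
    _ ≤ ∫⁻ z, liminf (fun k => ((Ψ k) ⁻¹' U).indicator (1 : Q × Q → ℝ≥0∞) z) atTop :=
          lintegral_mono hle
    _ ≤ liminf (fun k => ∫⁻ z, ((Ψ k) ⁻¹' U).indicator (1 : Q × Q → ℝ≥0∞) z) atTop :=
          lintegral_liminf_le fun k => (measurable_one.indicator (hmU.preimage (hΨc k).measurable))
    _ = liminf (fun _ : ℕ => volume U) atTop := by
          refine congrArg (fun f : ℕ → ℝ≥0∞ => liminf f atTop) (funext fun k => ?_)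
          rw [lintegral_indicator_one (hmU.preimage (hΨc k).measurable), (hΨm k).measure_preimage
            hmU.nullMeasurableSet]
    _ = volume U := liminf_const _

/-- `vol(Ψ_t⁻¹ A) ≤ vol A` for every set `A` (outer regularity of Lebesgue measure). [folklore] -/
theorem volume_preimage_le (hF : LipschitzWith K F) {M : ℝ} (hM : ∀ q, ‖F q‖ ≤ M) (t : ℝ)
    (A : Set (Q × Q)) : volume (flow hF t ⁻¹' A) ≤ volume A := by
  haveI : (volume : Measure (Q × Q)).IsAddHaarMeasure := Measure.prod.instIsAddHaarMeasure _ _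
  rw [A.measure_eq_iInf_isOpen volume]
  refine le_iInf₂ fun U hAU => le_iInf fun hU => ?_
  exact (measure_mono (preimage_mono hAU)).trans (volume_preimage_le_of_isOpen hF hM t hU)

/-- **Liouville's theorem** for `ẋ = v`, `v̇ = F(x)` with bounded Lipschitz force on `Q × Q`:
every flow map `Ψ_t` preserves Lebesgue measure (Arnold, *Mathematical Methods of Classical
Mechanics*, §16 Thm 1, "the phase flow preserves volume"; proof here without Jacobians, by the
volume-preserving symplectic Euler shears, Fatou and `Ψ_{-t} = Ψ_t⁻¹`, following
`NewtonianFlow.IsFlow.measurePreserving`). [cite: Arnold1989, §16 Thm 1] -/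
theorem measurePreserving_flow (hF : LipschitzWith K F) {M : ℝ} (hM : ∀ q, ‖F q‖ ≤ M) (t : ℝ) :
    MeasurePreserving (flow hF t) (volume : Measure (Q × Q)) volume := by
  have hmeas : Measurable (flow hF t) := (continuous_flow hF t).measurable
  refine ⟨hmeas, Measure.ext fun A hA => ?_⟩
  rw [Measure.map_apply hmeas hA]
  refine le_antisymm (volume_preimage_le hF hM t A) ?_
  have h := volume_preimage_le hF hM (-t) (flow hF t ⁻¹' A)
  have e : flow hF (-t) ⁻¹' (flow hF t ⁻¹' A) = A := by
    ext z
    simp [flow_flow_neg hF]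
  rwa [e] at h

end Liouville

end NewtonSystem

/-! ## B. The regularised profile `φ_δ` and pair potential `Φ_{δ,ε}` -/

namespace ShortRangePotential

variable {d : Type*} [Fintype d]

/-- The smooth step `χ_δ(r) = smoothTransition (2r/δ - 1)`: `0` for `r ≤ δ/2`, `1` for `r ≥ δ`.
[folklore] -/
def cutFn (δ r : ℝ) : ℝ := Real.smoothTransition (2 * r / δ - 1)

omit [Fintype d] in
/-- `χ_δ = 0` on `(-∞, δ/2]`. [folklore] -/
theorem cutFn_eq_zero {δ r : ℝ} (hδ : 0 < δ) (hr : r ≤ δ / 2) : cutFn δ r = 0 := by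
  apply Real.smoothTransition.zero_of_nonpos
  rw [sub_nonpos, div_le_one hδ]
  linarith

omit [Fintype d] in
/-- `χ_δ = 1` on `[δ, ∞)`. [folklore] -/
theorem cutFn_eq_one {δ r : ℝ} (hδ : 0 < δ) (hr : δ ≤ r) : cutFn δ r = 1 := by
  apply Real.smoothTransition.one_of_one_le
  rw [le_sub_iff_add_le, le_div_iff₀ hδ]
  linarith

omit [Fintype d] in
/-- `0 ≤ χ_δ`. [folklore] -/
theorem cutFn_nonneg (δ r : ℝ) : 0 ≤ cutFn δ r := Real.smoothTransition.nonneg _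

omit [Fintype d] in
/-- `χ_δ ≤ 1`. [folklore] -/
theorem cutFn_le_one (δ r : ℝ) : cutFn δ r ≤ 1 := Real.smoothTransition.le_one _

omit [Fintype d] in
/-- `χ_δ` is smooth. [folklore] -/
theorem contDiff_cutFn (δ : ℝ) {n : ℕ∞} : ContDiff ℝ n (cutFn δ) := by
  unfold cutFn
  exact Real.smoothTransition.contDiff.comp
    (((contDiff_const.mul contDiff_id).div_const δ).sub contDiff_const)

/-- The **regularised profile** `φ_δ := χ_δ φ + (1 - χ_δ) φ(δ/2)`: it agrees with `φ` on
`[δ, ∞)`, is the constant `φ(δ/2)` on `(-∞, δ/2]`, is `C²` on all of `ℝ`, and stays `≥ φ(δ)`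
on `(-∞, δ]` (so it still confines the motion below the energy `φ(δ)`). [folklore] -/
def regProfile (Φ : ShortRangePotential d) (δ r : ℝ) : ℝ :=
  cutFn δ r * Φ.φ r + (1 - cutFn δ r) * Φ.φ (δ / 2)

omit [Fintype d] in
/-- `φ_δ = φ` on `[δ, ∞)`. [folklore] -/
theorem regProfile_eq_of_le (Φ : ShortRangePotential d) {δ r : ℝ} (hδ : 0 < δ) (hr : δ ≤ r) :
    Φ.regProfile δ r = Φ.φ r := by
  simp [regProfile, cutFn_eq_one hδ hr]

omit [Fintype d] in
/-- `φ_δ = φ(δ/2)` on `(-∞, δ/2]`. [folklore] -/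
theorem regProfile_eq_const (Φ : ShortRangePotential d) {δ r : ℝ} (hδ : 0 < δ)
    (hr : r ≤ δ / 2) : Φ.regProfile δ r = Φ.φ (δ / 2) := by
  simp [regProfile, cutFn_eq_zero hδ hr]

omit [Fintype d] in
/-- `φ_δ ≥ 0`. [folklore] -/
theorem regProfile_nonneg (Φ : ShortRangePotential d) (δ r : ℝ) : 0 ≤ Φ.regProfile δ r :=
  add_nonneg (mul_nonneg (cutFn_nonneg δ r) (Φ.nonneg r))
    (mul_nonneg (sub_nonneg.2 (cutFn_le_one δ r)) (Φ.nonneg _))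

omit [Fintype d] in
/-- **Confinement**: `φ(δ) ≤ φ_δ(r)` for every `r ≤ δ` (on `(δ/2, δ]` the value is a convex
combination of `φ(r) ≥ φ(δ)` and `φ(δ/2) ≥ φ(δ)`, below `δ/2` it is `φ(δ/2)`). [folklore] -/
theorem le_regProfile (Φ : ShortRangePotential d) {δ r : ℝ} (hδ : 0 < δ) (hr : r ≤ δ) :
    Φ.φ δ ≤ Φ.regProfile δ r := by
  have h2 : Φ.φ δ ≤ Φ.φ (δ / 2) :=
    Φ.antitoneOn (show (0 : ℝ) < δ / 2 by positivity) hδ (by linarith)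
  rcases le_or_gt r (δ / 2) with h | h
  · rw [Φ.regProfile_eq_const hδ h]; exact h2
  · have hr0 : 0 < r := lt_trans (by positivity) h
    have h1 : Φ.φ δ ≤ Φ.φ r := Φ.antitoneOn hr0 hδ hr
    have hc0 := cutFn_nonneg δ r
    have hc1 := cutFn_le_one δ r
    unfold regProfile
    nlinarith

omit [Fintype d] in
/-- `φ_δ = 0` on `[1, ∞)` when `δ ≤ 1` (finite range). [folklore] -/
theorem regProfile_eq_zero (Φ : ShortRangePotential d) {δ r : ℝ} (hδ : 0 < δ) (hδ1 : δ ≤ 1)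
    (hr : 1 ≤ r) : Φ.regProfile δ r = 0 := by
  rw [Φ.regProfile_eq_of_le hδ (hδ1.trans hr), Φ.eq_zero_of_one_le r hr]

omit [Fintype d] in
/-- `φ_δ` is `C²` on `(0, ∞)`. [folklore] -/
theorem contDiffOn_regProfile (Φ : ShortRangePotential d) (δ : ℝ) :
    ContDiffOn ℝ 2 (Φ.regProfile δ) (Ioi 0) := by
  unfold regProfile
  exact ((contDiff_cutFn δ).contDiffOn.mul Φ.contDiffOn).add
    ((contDiff_const.sub (contDiff_cutFn δ)).contDiffOn.mul contDiffOn_const)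

omit [Fintype d] in
/-- `φ_δ` is `C²` on `ℝ` (it is locally constant near every `r ≤ 0`). [folklore] -/
theorem contDiff_regProfile (Φ : ShortRangePotential d) {δ : ℝ} (hδ : 0 < δ) :
    ContDiff ℝ 2 (Φ.regProfile δ) := by
  refine contDiff_iff_contDiffAt.2 fun r => ?_
  rcases le_or_gt r 0 with hr | hr
  · have hev : Φ.regProfile δ =ᶠ[𝓝 r] fun _ => Φ.φ (δ / 2) := by
      filter_upwards [Iio_mem_nhds (show r < δ / 2 by linarith)] with s hs
      exact Φ.regProfile_eq_const hδ hs.le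
    exact (contDiffAt_const.congr_of_eventuallyEq hev)
  · exact (Φ.contDiffOn_regProfile δ).contDiffAt (Ioi_mem_nhds hr)

/-- The **regularised pair potential** `Φ_{δ,ε}(y) = φ_δ(|y|/ε)`. [folklore] -/
def regPot (Φ : ShortRangePotential d) (δ ε : ℝ) (y : EuclideanSpace ℝ d) : ℝ :=
  Φ.regProfile δ (‖y‖ / ε)

/-- `Φ_{δ,ε}` is even. [folklore] -/
theorem regPot_neg (Φ : ShortRangePotential d) (δ ε : ℝ) (y : EuclideanSpace ℝ d) :
    Φ.regPot δ ε (-y) = Φ.regPot δ ε y := by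
  simp [regPot, norm_neg]

/-- `Φ_{δ,ε} ≥ 0`. [folklore] -/
theorem regPot_nonneg (Φ : ShortRangePotential d) (δ ε : ℝ) (y : EuclideanSpace ℝ d) :
    0 ≤ Φ.regPot δ ε y :=
  Φ.regProfile_nonneg δ _

/-- Outside the ball of radius `εδ` the regularised potential is the true one,
`Φ_{δ,ε}(y) = φ(|y|/ε)`. [folklore] -/
theorem regPot_eq_of_le (Φ : ShortRangePotential d) {δ ε : ℝ} (hδ : 0 < δ) (hε : 0 < ε)
    {y : EuclideanSpace ℝ d} (hy : ε * δ ≤ ‖y‖) : Φ.regPot δ ε y = Φ.φ (‖y‖ / ε) :=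
  Φ.regProfile_eq_of_le hδ ((le_div_iff₀' hε).2 hy)

/-- The rescaled true potential in the same form: `Φ_ε(y) = φ(|y|/ε)` for `ε > 0`. [folklore] -/
theorem scaled_eq_div (Φ : ShortRangePotential d) {ε : ℝ} (hε : 0 < ε) (y : EuclideanSpace ℝ d) :
    Φ.scaled ε y = Φ.φ (‖y‖ / ε) := by
  rw [Φ.scaled_apply, norm_smul, norm_inv, Real.norm_of_nonneg hε.le, inv_mul_eq_div]

/-- **Confinement**: inside the closed ball of radius `εδ`, `φ(δ) ≤ Φ_{δ,ε}`. [folklore] -/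
theorem le_regPot (Φ : ShortRangePotential d) {δ ε : ℝ} (hδ : 0 < δ) (hε : 0 < ε)
    {y : EuclideanSpace ℝ d} (hy : ‖y‖ ≤ ε * δ) : Φ.φ δ ≤ Φ.regPot δ ε y :=
  Φ.le_regProfile hδ ((div_le_iff₀' hε).2 hy)

/-- `Φ_{δ,ε}` is constant (`= φ(δ/2)`) on the ball of radius `εδ/2`. [folklore] -/
theorem regPot_eq_const (Φ : ShortRangePotential d) {δ ε : ℝ} (hδ : 0 < δ) (hε : 0 < ε)
    {y : EuclideanSpace ℝ d} (hy : ‖y‖ ≤ ε * δ / 2) : Φ.regPot δ ε y = Φ.φ (δ / 2) :=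
  Φ.regProfile_eq_const hδ ((div_le_iff₀' hε).2 (by linarith))

/-- `Φ_{δ,ε} = 0` outside the ball of radius `ε` (for `δ ≤ 1`). [folklore] -/
theorem regPot_eq_zero (Φ : ShortRangePotential d) {δ ε : ℝ} (hδ : 0 < δ) (hδ1 : δ ≤ 1)
    (hε : 0 < ε) {y : EuclideanSpace ℝ d} (hy : ε ≤ ‖y‖) : Φ.regPot δ ε y = 0 :=
  Φ.regProfile_eq_zero hδ hδ1 ((one_le_div hε).2 hy)

/-- `Φ_{δ,ε}` is `C²` on `ℝ^d` (smooth norm off the origin, constant near the origin).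
[folklore] -/
theorem contDiff_regPot (Φ : ShortRangePotential d) {δ ε : ℝ} (hδ : 0 < δ) (hε : 0 < ε) :
    ContDiff ℝ 2 (Φ.regPot δ ε) := by
  refine contDiff_iff_contDiffAt.2 fun y => ?_
  by_cases hy : y = 0
  · subst hy
    have hev : Φ.regPot δ ε =ᶠ[𝓝 0] fun _ => Φ.φ (δ / 2) := by
      filter_upwards [Metric.ball_mem_nhds (0 : EuclideanSpace ℝ d)
        (show 0 < ε * δ / 2 by positivity)] with y hy
      exact Φ.regPot_eq_const hδ hε (le_of_lt (by simpa using hy))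
    exact contDiffAt_const.congr_of_eventuallyEq hev
  · have h1 : ContDiffAt ℝ 2 (fun y : EuclideanSpace ℝ d => ‖y‖ / ε) y :=
      (contDiffAt_norm ℝ hy).div_const ε
    exact (Φ.contDiff_regProfile hδ).contDiffAt.comp y h1

/-- `Φ_{δ,ε}` is differentiable. [folklore] -/
theorem differentiable_regPot (Φ : ShortRangePotential d) {δ ε : ℝ} (hδ : 0 < δ) (hε : 0 < ε) :
    Differentiable ℝ (Φ.regPot δ ε) :=
  (Φ.contDiff_regPot hδ hε).differentiable (by norm_num)

/-- The gradient of `Φ_{δ,ε}` is `C¹`. [folklore] -/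
theorem contDiff_gradient_regPot (Φ : ShortRangePotential d) {δ ε : ℝ} (hδ : 0 < δ)
    (hε : 0 < ε) : ContDiff ℝ 1 (gradient (Φ.regPot δ ε)) := by
  have h : ContDiff ℝ 1 (fderiv ℝ (Φ.regPot δ ε)) :=
    (Φ.contDiff_regPot hδ hε).fderiv_right (m := 1) (by norm_num)
  exact (InnerProductSpace.toDual ℝ (EuclideanSpace ℝ d)).symm.contDiff.comp h

/-- The gradient of `Φ_{δ,ε}` vanishes outside the closed ball of radius `ε` (`δ ≤ 1`).
[folklore] -/
theorem gradient_regPot_eq_zero (Φ : ShortRangePotential d) {δ ε : ℝ} (hδ : 0 < δ)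
    (hδ1 : δ ≤ 1) (hε : 0 < ε) {y : EuclideanSpace ℝ d} (hy : ε < ‖y‖) :
    gradient (Φ.regPot δ ε) y = 0 := by
  have hev : Φ.regPot δ ε =ᶠ[𝓝 y] fun _ => (0 : ℝ) := by
    have ho : IsOpen {y : EuclideanSpace ℝ d | ε < ‖y‖} := isOpen_lt continuous_const continuous_norm
    filter_upwards [ho.mem_nhds hy] with y' hy'
    exact Φ.regPot_eq_zero hδ hδ1 hε (le_of_lt hy')
  unfold gradient
  rw [hev.fderiv_eq]
  simp

/-- The gradient of `Φ_{δ,ε}` has compact support. [folklore] -/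
theorem hasCompactSupport_gradient_regPot (Φ : ShortRangePotential d) {δ ε : ℝ} (hδ : 0 < δ)
    (hδ1 : δ ≤ 1) (hε : 0 < ε) : HasCompactSupport (gradient (Φ.regPot δ ε)) := by
  refine HasCompactSupport.intro (isCompact_closedBall (0 : EuclideanSpace ℝ d) ε) fun y hy => ?_
  rw [mem_closedBall, dist_zero_right, not_le] at hy
  exact Φ.gradient_regPot_eq_zero hδ hδ1 hε hy

/-- The gradient of `Φ_{δ,ε}` is globally Lipschitz. [folklore] -/
theorem exists_lipschitzWith_gradient_regPot (Φ : ShortRangePotential d) {δ ε : ℝ} (hδ : 0 < δ)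
    (hδ1 : δ ≤ 1) (hε : 0 < ε) : ∃ L : ℝ≥0, LipschitzWith L (gradient (Φ.regPot δ ε)) :=
  (Φ.contDiff_gradient_regPot hδ hε).lipschitzWith_of_hasCompactSupport
    (Φ.hasCompactSupport_gradient_regPot hδ hδ1 hε) one_ne_zero

/-- The gradient of `Φ_{δ,ε}` is bounded. [folklore] -/
theorem exists_bound_gradient_regPot (Φ : ShortRangePotential d) {δ ε : ℝ} (hδ : 0 < δ)
    (hδ1 : δ ≤ 1) (hε : 0 < ε) : ∃ C : ℝ, ∀ y, ‖gradient (Φ.regPot δ ε) y‖ ≤ C :=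
  (Φ.contDiff_gradient_regPot hδ hε).continuous.bounded_above_of_compact_support
    (Φ.hasCompactSupport_gradient_regPot hδ hδ1 hε)

/-- Outside the closed ball of radius `εδ` the regularised force is the true force:
`∇Φ_{δ,ε}(y) = ∇Φ_ε(y)`. [folklore] -/
theorem gradient_regPot_eq (Φ : ShortRangePotential d) {δ ε : ℝ} (hδ : 0 < δ) (hε : 0 < ε)
    {y : EuclideanSpace ℝ d} (hy : ε * δ < ‖y‖) :
    gradient (Φ.regPot δ ε) y = gradient (Φ.scaled ε) y := by
  have hev : Φ.regPot δ ε =ᶠ[𝓝 y] Φ.scaled ε := by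
    have ho : IsOpen {y : EuclideanSpace ℝ d | ε * δ < ‖y‖} :=
      isOpen_lt continuous_const continuous_norm
    filter_upwards [ho.mem_nhds hy] with y' hy'
    rw [Φ.regPot_eq_of_le hδ hε (le_of_lt hy'), Φ.scaled_eq_div hε]
  unfold gradient
  rw [hev.fderiv_eq]

/-- The regularised force is odd: `∇Φ_{δ,ε}(-y) = -∇Φ_{δ,ε}(y)` (the potential is even).
[folklore] -/
theorem gradient_regPot_neg (Φ : ShortRangePotential d) {δ ε : ℝ} (hδ : 0 < δ) (hε : 0 < ε)
    (y : EuclideanSpace ℝ d) :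
    gradient (Φ.regPot δ ε) (-y) = -gradient (Φ.regPot δ ε) y := by
  have hdiff := Φ.differentiable_regPot hδ hε
  -- `P ∘ neg = P`, so `fderiv P y = (fderiv P (-y)) ∘ (-id)`
  have hcomp : HasFDerivAt (fun x => Φ.regPot δ ε (-x))
      ((fderiv ℝ (Φ.regPot δ ε) (-y)).comp (-ContinuousLinearMap.id ℝ (EuclideanSpace ℝ d))) y :=
    (hdiff (-y)).hasFDerivAt.comp y (hasFDerivAt_id y).neg
  have hfun : (fun x => Φ.regPot δ ε (-x)) = Φ.regPot δ ε := funext fun x => Φ.regPot_neg δ ε x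
  rw [hfun] at hcomp
  have hfd : fderiv ℝ (Φ.regPot δ ε) y = -(fderiv ℝ (Φ.regPot δ ε) (-y)) := by
    rw [hcomp.fderiv]; ext v; simp
  unfold gradient
  rw [hfd, map_neg, neg_neg]

/-- The regularised force vanishes at the origin. [folklore] -/
theorem gradient_regPot_zero (Φ : ShortRangePotential d) {δ ε : ℝ} (hδ : 0 < δ) (hε : 0 < ε) :
    gradient (Φ.regPot δ ε) 0 = 0 := by
  have h := Φ.gradient_regPot_neg hδ hε 0
  rw [neg_zero] at h
  have h2 : (2 : ℝ) • gradient (Φ.regPot δ ε) 0 = 0 := by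
    rw [two_smul]
    nth_rewrite 2 [h]
    exact add_neg_cancel _
  exact (smul_eq_zero.1 h2).resolve_left two_ne_zero

/-- `⟪∇f(x), w⟫ = Df(x) w`. [folklore] -/
theorem inner_gradient_eq_fderiv (f : EuclideanSpace ℝ d → ℝ) (x w : EuclideanSpace ℝ d) :
    ⟪gradient f x, w⟫_ℝ = fderiv ℝ f x w := by
  rw [gradient, InnerProductSpace.toDual_symm_apply]

/-- Chain rule along a curve: `d/dt Φ_{δ,ε}(c(t)) = ⟪∇Φ_{δ,ε}(c(t)), c'(t)⟫`. [folklore] -/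
theorem hasDerivAt_regPot_comp (Φ : ShortRangePotential d) {δ ε : ℝ} (hδ : 0 < δ) (hε : 0 < ε)
    {c : ℝ → EuclideanSpace ℝ d} {c' : EuclideanSpace ℝ d} {t : ℝ} (hc : HasDerivAt c c' t) :
    HasDerivAt (fun s => Φ.regPot δ ε (c s)) ⟪gradient (Φ.regPot δ ε) (c t), c'⟫_ℝ t := by
  have h := (Φ.differentiable_regPot hδ hε (c t)).hasFDerivAt.comp_hasDerivAt t hc
  rw [inner_gradient_eq_fderiv]
  exact h

end ShortRangePotential


/-! ## C. The regularised `N`-body system on `(ℝ^d)^N × (ℝ^d)^N` -/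

namespace PotentialFlow.NonemptyEuclidean

variable {d : Type*} [Fintype d] {N : ℕ}

/-- The pair force field of an (odd) pair interaction force `-g`:
`F(x)_i = -∑_{j ≠ i} g(x_i - x_j)`. [folklore] -/
def pairForce (g : EuclideanSpace ℝ d → EuclideanSpace ℝ d) (x : Fin N → EuclideanSpace ℝ d) :
    Fin N → EuclideanSpace ℝ d :=
  fun i => -∑ j ∈ Finset.univ.erase i, g (x i - x j)

omit [Fintype d] in
/-- Components of the pair force. [folklore] -/
theorem pairForce_apply (g : EuclideanSpace ℝ d → EuclideanSpace ℝ d)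
    (x : Fin N → EuclideanSpace ℝ d) (i : Fin N) :
    pairForce g x i = -∑ j ∈ Finset.univ.erase i, g (x i - x j) := rfl

omit [Fintype d] in
/-- With `g 0 = 0` the diagonal term may be added: `F(x)_i = -∑_j g(x_i - x_j)`. [folklore] -/
theorem pairForce_apply_eq_sum_univ {g : EuclideanSpace ℝ d → EuclideanSpace ℝ d} (hg0 : g 0 = 0)
    (x : Fin N → EuclideanSpace ℝ d) (i : Fin N) :
    pairForce g x i = -∑ j, g (x i - x j) := by
  rw [pairForce_apply, Finset.sum_erase]
  rw [sub_self, hg0]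

/-- The pair force field is globally Lipschitz when `g` is (constant `2NL`). [folklore] -/
theorem lipschitzWith_pairForce {g : EuclideanSpace ℝ d → EuclideanSpace ℝ d} {L : ℝ≥0}
    (hg : LipschitzWith L g) : LipschitzWith (2 * N * L) (pairForce (N := N) g) := by
  refine LipschitzWith.of_dist_le_mul fun x y => ?_
  rw [dist_eq_norm, dist_eq_norm]
  have hcoe : ((2 * N * L : ℝ≥0) : ℝ) = 2 * N * L := by push_cast; ring
  rw [hcoe]
  refine (pi_norm_le_iff_of_nonneg (by positivity)).2 fun i => ?_
  have hxy : ∀ k, ‖x k - y k‖ ≤ ‖x - y‖ := fun k => norm_le_pi_norm (x - y) k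
  rw [Pi.sub_apply, pairForce_apply, pairForce_apply, neg_sub_neg, ← Finset.sum_sub_distrib]
  calc ‖∑ j ∈ Finset.univ.erase i, (g (y i - y j) - g (x i - x j))‖
      ≤ ∑ j ∈ Finset.univ.erase i, ‖g (y i - y j) - g (x i - x j)‖ := norm_sum_le _ _
    _ ≤ ∑ j ∈ Finset.univ.erase i, (L : ℝ) * (2 * ‖x - y‖) := by
        refine Finset.sum_le_sum fun j _ => (hg.norm_sub_le _ _).trans ?_
        refine mul_le_mul_of_nonneg_left ?_ L.2
        calc ‖y i - y j - (x i - x j)‖ = ‖(x i - y i) - (x j - y j)‖ := by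
              rw [← norm_neg]; congr 1; abel
          _ ≤ ‖x i - y i‖ + ‖x j - y j‖ := norm_sub_le _ _
          _ ≤ ‖x - y‖ + ‖x - y‖ := add_le_add (hxy i) (hxy j)
          _ = 2 * ‖x - y‖ := by ring
    _ ≤ ∑ _j ∈ (Finset.univ : Finset (Fin N)), (L : ℝ) * (2 * ‖x - y‖) :=
        Finset.sum_le_sum_of_subset_of_nonneg (Finset.erase_subset _ _)
          (fun _ _ _ => by positivity)
    _ = 2 * N * L * ‖x - y‖ := by
        rw [Finset.sum_const, Finset.card_univ, Fintype.card_fin, nsmul_eq_mul]; ring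

/-- The pair force field is bounded when `g` is: `‖F(x)‖ ≤ N C`. [folklore] -/
theorem norm_pairForce_le {g : EuclideanSpace ℝ d → EuclideanSpace ℝ d} {C : ℝ}
    (hC : ∀ y, ‖g y‖ ≤ C) (x : Fin N → EuclideanSpace ℝ d) : ‖pairForce g x‖ ≤ N * C := by
  have hC0 : 0 ≤ C := (norm_nonneg _).trans (hC 0)
  refine (pi_norm_le_iff_of_nonneg (by positivity)).2 fun i => ?_
  rw [pairForce_apply, norm_neg]
  calc ‖∑ j ∈ Finset.univ.erase i, g (x i - x j)‖
      ≤ ∑ j ∈ Finset.univ.erase i, ‖g (x i - x j)‖ := norm_sum_le _ _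
    _ ≤ ∑ j ∈ Finset.univ.erase i, C := Finset.sum_le_sum fun j _ => hC _
    _ ≤ ∑ _j ∈ (Finset.univ : Finset (Fin N)), C :=
        Finset.sum_le_sum_of_subset_of_nonneg (Finset.erase_subset _ _) (fun _ _ _ => hC0)
    _ = N * C := by rw [Finset.sum_const, Finset.card_univ, Fintype.card_fin, nsmul_eq_mul]

/-- The **pair energy** `H_P(x, v) = ½ ∑_i |v_i|² + ½ ∑_i ∑_{j ≠ i} P(x_i - x_j)` of a pair
potential `P` (each unordered pair counted once when `P` is even). [folklore] -/
def pairEnergy (P : EuclideanSpace ℝ d → ℝ)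
    (z : (Fin N → EuclideanSpace ℝ d) × (Fin N → EuclideanSpace ℝ d)) : ℝ :=
  2⁻¹ * ∑ i, ‖z.2 i‖ ^ 2 + 2⁻¹ * ∑ i, ∑ j ∈ Finset.univ.erase i, P (z.1 i - z.1 j)

/-- A single pair term is dominated by the pair energy (for `P ≥ 0` even). [folklore] -/
theorem apply_le_pairEnergy {P : EuclideanSpace ℝ d → ℝ} (hP : ∀ y, 0 ≤ P y)
    (hPe : ∀ y, P (-y) = P y) (z : (Fin N → EuclideanSpace ℝ d) × (Fin N → EuclideanSpace ℝ d))
    {i j : Fin N} (hij : i ≠ j) : P (z.1 i - z.1 j) ≤ pairEnergy P z := by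
  have hkin : 0 ≤ 2⁻¹ * ∑ i, ‖z.2 i‖ ^ 2 := by positivity
  have hrow : ∀ k, 0 ≤ ∑ l ∈ Finset.univ.erase k, P (z.1 k - z.1 l) :=
    fun k => Finset.sum_nonneg fun l _ => hP _
  have hi : P (z.1 i - z.1 j) ≤ ∑ l ∈ Finset.univ.erase i, P (z.1 i - z.1 l) :=
    Finset.single_le_sum (f := fun l => P (z.1 i - z.1 l)) (fun l _ => hP _)
      (Finset.mem_erase.2 ⟨hij.symm, Finset.mem_univ j⟩)
  have hj : P (z.1 i - z.1 j) ≤ ∑ l ∈ Finset.univ.erase j, P (z.1 j - z.1 l) := by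
    have h := Finset.single_le_sum (f := fun l => P (z.1 j - z.1 l)) (fun l _ => hP _)
      (Finset.mem_erase.2 ⟨hij, Finset.mem_univ i⟩)
    have e : P (z.1 j - z.1 i) = P (z.1 i - z.1 j) := by rw [← hPe, neg_sub]
    simpa only [e] using h
  have h2 := Finset.add_le_sum (f := fun k => ∑ l ∈ Finset.univ.erase k, P (z.1 k - z.1 l))
    (fun k _ => hrow k) (Finset.mem_univ i) (Finset.mem_univ j) hij
  unfold pairEnergy
  linarith

/-- The pair energy only depends on the values of `P` at the separations `x_i - x_j`, `i ≠ j`.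
[folklore] -/
theorem pairEnergy_congr {P P' : EuclideanSpace ℝ d → ℝ}
    {z : (Fin N → EuclideanSpace ℝ d) × (Fin N → EuclideanSpace ℝ d)}
    (h : ∀ i j, i ≠ j → P (z.1 i - z.1 j) = P' (z.1 i - z.1 j)) :
    pairEnergy P z = pairEnergy P' z := by
  unfold pairEnergy
  congr 2
  refine Finset.sum_congr rfl fun i _ => Finset.sum_congr rfl fun j hj => ?_
  exact h i j (Finset.ne_of_mem_erase hj).symm

/-- The pair energy is nonnegative for `P ≥ 0`. [folklore] -/
theorem pairEnergy_nonneg {P : EuclideanSpace ℝ d → ℝ} (hP : ∀ y, 0 ≤ P y)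
    (z : (Fin N → EuclideanSpace ℝ d) × (Fin N → EuclideanSpace ℝ d)) : 0 ≤ pairEnergy P z := by
  unfold pairEnergy
  have : 0 ≤ ∑ i, ∑ j ∈ Finset.univ.erase i, P (z.1 i - z.1 j) :=
    Finset.sum_nonneg fun i _ => Finset.sum_nonneg fun j _ => hP _
  positivity

/-- The algebraic identity behind conservation of energy: for an odd pair force `g`,
`∑_i ∑_j ⟪g(x_i - x_j), v_i - v_j⟫ = 2 ∑_i ∑_j ⟪g(x_i - x_j), v_i⟫`. [folklore] -/
theorem sum_sum_inner_sub {g : EuclideanSpace ℝ d → EuclideanSpace ℝ d} (hg : ∀ y, g (-y) = -g y)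
    (x v : Fin N → EuclideanSpace ℝ d) :
    ∑ i, ∑ j, ⟪g (x i - x j), v i - v j⟫_ℝ = 2 * ∑ i, ∑ j, ⟪g (x i - x j), v i⟫_ℝ := by
  have hB : ∑ i, ∑ j, ⟪g (x i - x j), v j⟫_ℝ = -∑ i, ∑ j, ⟪g (x i - x j), v i⟫_ℝ := by
    rw [Finset.sum_comm]
    rw [← Finset.sum_neg_distrib]
    refine Finset.sum_congr rfl fun j _ => ?_
    rw [← Finset.sum_neg_distrib]
    refine Finset.sum_congr rfl fun i _ => ?_
    rw [← inner_neg_left, ← hg, neg_sub]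
  simp_rw [inner_sub_right, Finset.sum_sub_distrib]
  rw [hB]
  ring

/-- **Conservation of the pair energy** along Newtonian trajectories of the pair force: if
`d/dt P(c(t)) = ⟪g(c(t)), c'(t)⟫` along curves (i.e. `g = ∇P`) and `g` is odd, then
`t ↦ H_P(γ(t))` has zero derivative along every integral curve `γ` of `X_{F}`, `F = pairForce g`.
[folklore] -/
theorem hasDerivAt_pairEnergy {P : EuclideanSpace ℝ d → ℝ}
    {g : EuclideanSpace ℝ d → EuclideanSpace ℝ d}
    (hPg : ∀ {c : ℝ → EuclideanSpace ℝ d} {c' : EuclideanSpace ℝ d} {t : ℝ}, HasDerivAt c c' t →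
      HasDerivAt (fun s => P (c s)) ⟪g (c t), c'⟫_ℝ t)
    (hg : ∀ y, g (-y) = -g y)
    {γ : ℝ → (Fin N → EuclideanSpace ℝ d) × (Fin N → EuclideanSpace ℝ d)}
    {t : ℝ} (hγ : HasDerivAt γ (NewtonSystem.vectorField (pairForce g) (γ t)) t) :
    HasDerivAt (fun s => pairEnergy P (γ s)) 0 t := by
  have hg0 : g 0 = 0 := by
    have h := hg 0
    rw [neg_zero] at h
    have h2 : (2 : ℝ) • g 0 = 0 := by
      rw [two_smul]; nth_rewrite 2 [h]; exact add_neg_cancel _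
    exact (smul_eq_zero.1 h2).resolve_left two_ne_zero
  -- components
  have hx : ∀ i, HasDerivAt (fun s => (γ s).1 i) ((γ t).2 i) t := fun i =>
    (hasDerivAt_pi.1 hγ.fst) i
  have hv : ∀ i, HasDerivAt (fun s => (γ s).2 i) (pairForce g (γ t).1 i) t := fun i =>
    (hasDerivAt_pi.1 hγ.snd) i
  set x := (γ t).1 with hxdef
  set v := (γ t).2 with hvdef
  -- kinetic part
  have hkin : HasDerivAt (fun s => 2⁻¹ * ∑ i, ‖(γ s).2 i‖ ^ 2)
      (2⁻¹ * ∑ i, 2 * ⟪v i, pairForce g x i⟫_ℝ) t :=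
    (HasDerivAt.fun_sum fun i _ => (hv i).norm_sq).const_mul _
  -- potential part
  have hpot : HasDerivAt
      (fun s => 2⁻¹ * ∑ i, ∑ j ∈ Finset.univ.erase i, P ((γ s).1 i - (γ s).1 j))
      (2⁻¹ * ∑ i, ∑ j ∈ Finset.univ.erase i, ⟪g (x i - x j), v i - v j⟫_ℝ) t :=
    (HasDerivAt.fun_sum fun i _ => HasDerivAt.fun_sum fun j _ =>
      hPg ((hx i).sub (hx j))).const_mul _
  have hsum := hkin.add hpot
  refine hsum.congr_deriv ?_
  -- the algebra
  have h1 : ∀ i, ∑ j ∈ Finset.univ.erase i, ⟪g (x i - x j), v i - v j⟫_ℝ =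
      ∑ j, ⟪g (x i - x j), v i - v j⟫_ℝ := fun i => by
    apply Finset.sum_erase
    simp
  have h2 : ∀ i, pairForce g x i = -∑ j, g (x i - x j) := pairForce_apply_eq_sum_univ hg0 x
  have h3 : ∑ i, ∑ j ∈ Finset.univ.erase i, ⟪g (x i - x j), v i - v j⟫_ℝ =
      -2 * ∑ i, ⟪v i, pairForce g x i⟫_ℝ := by
    calc ∑ i, ∑ j ∈ Finset.univ.erase i, ⟪g (x i - x j), v i - v j⟫_ℝ
        = ∑ i, ∑ j, ⟪g (x i - x j), v i - v j⟫_ℝ := Finset.sum_congr rfl fun i _ => h1 i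
      _ = 2 * ∑ i, ∑ j, ⟪g (x i - x j), v i⟫_ℝ := sum_sum_inner_sub hg x v
      _ = 2 * ∑ i, ⟪∑ j, g (x i - x j), v i⟫_ℝ := by simp_rw [sum_inner]
      _ = 2 * ∑ i, ⟪-pairForce g x i, v i⟫_ℝ := by
          congr 1
          refine Finset.sum_congr rfl fun i _ => ?_
          rw [h2, neg_neg]
      _ = -2 * ∑ i, ⟪v i, pairForce g x i⟫_ℝ := by
          rw [show (∑ i, ⟪-pairForce g x i, v i⟫_ℝ) = -∑ i, ⟪v i, pairForce g x i⟫_ℝ by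
            rw [← Finset.sum_neg_distrib]
            exact Finset.sum_congr rfl fun i _ => by rw [inner_neg_left, real_inner_comm]]
          ring
  rw [h3, ← Finset.mul_sum]
  ring

end PotentialFlow.NonemptyEuclidean


/-! ## D. Assembly: the `N`-body flow of a short-range potential in `ℝ^d` -/

namespace PotentialFlow.NonemptyEuclidean

variable {d : Type*} [Fintype d] {N : ℕ}

/-! ### The energy floors `δ_n` -/

omit [Fintype d] in
/-- For every level `n` there is a radius `δ ∈ (0, 1]` below which the pair potential exceeds
`n + 1` (`φ → +∞` at `0⁺`). [folklore] -/
theorem exists_delta (Φ : ShortRangePotential d) (n : ℕ) :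
    ∃ δ : ℝ, 0 < δ ∧ δ ≤ 1 ∧ (n : ℝ) + 1 < Φ.φ δ := by
  have h1 : ∀ᶠ r in 𝓝[>] (0 : ℝ), (n : ℝ) + 1 < Φ.φ r :=
    Φ.tendsto_zero.eventually (eventually_gt_atTop _)
  have h2 : ∀ᶠ r in 𝓝[>] (0 : ℝ), r ∈ Ioo (0 : ℝ) 1 := Ioo_mem_nhdsGT zero_lt_one
  obtain ⟨δ, hδ, hmem⟩ := (h1.and h2).exists
  exact ⟨δ, hmem.1, hmem.2.le, hδ⟩

/-- The energy floor `δ_n ∈ (0, 1]` of level `n`: `φ(δ_n) > n + 1` (a choice). [folklore] -/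
def delta (Φ : ShortRangePotential d) (n : ℕ) : ℝ := (exists_delta Φ n).choose

omit [Fintype d] in
/-- `0 < δ_n`. [folklore] -/
theorem delta_pos (Φ : ShortRangePotential d) (n : ℕ) : 0 < delta Φ n :=
  (exists_delta Φ n).choose_spec.1

omit [Fintype d] in
/-- `δ_n ≤ 1`. [folklore] -/
theorem delta_le_one (Φ : ShortRangePotential d) (n : ℕ) : delta Φ n ≤ 1 :=
  (exists_delta Φ n).choose_spec.2.1

omit [Fintype d] in
/-- `n + 1 < φ(δ_n)`. [folklore] -/
theorem lt_phi_delta (Φ : ShortRangePotential d) (n : ℕ) : (n : ℝ) + 1 < Φ.φ (delta Φ n) :=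
  (exists_delta Φ n).choose_spec.2.2

/-! ### The regularised force of level `n` and its global flow -/

/-- The regularised force of level `n`: `F_n(x)_i = -∑_{j ≠ i} ∇Φ_{δ_n,ε}(x_i - x_j)`. [folklore] -/
def levelForce (Φ : ShortRangePotential d) (ε : ℝ) (n : ℕ) :
    (Fin N → EuclideanSpace ℝ d) → (Fin N → EuclideanSpace ℝ d) :=
  pairForce (gradient (Φ.regPot (delta Φ n) ε))

/-- The regularised force of level `n` is globally Lipschitz. [folklore] -/
theorem exists_lipschitzWith_levelForce (Φ : ShortRangePotential d) {ε : ℝ} (hε : 0 < ε) (n : ℕ) :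
    ∃ K : ℝ≥0, LipschitzWith K (levelForce (N := N) Φ ε n) := by
  obtain ⟨L, hL⟩ := Φ.exists_lipschitzWith_gradient_regPot (delta_pos Φ n) (delta_le_one Φ n) hε
  exact ⟨_, lipschitzWith_pairForce hL⟩

/-- A Lipschitz constant of the level-`n` force (a choice). [folklore] -/
def levelLip (Φ : ShortRangePotential d) {ε : ℝ} (hε : 0 < ε) (n : ℕ) : ℝ≥0 :=
  (exists_lipschitzWith_levelForce (N := N) Φ hε n).choose

/-- The chosen Lipschitz constant works. [folklore] -/
theorem lipschitzWith_levelForce (Φ : ShortRangePotential d) {ε : ℝ} (hε : 0 < ε) (n : ℕ) :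
    LipschitzWith (levelLip (N := N) Φ hε n) (levelForce (N := N) Φ ε n) :=
  (exists_lipschitzWith_levelForce (N := N) Φ hε n).choose_spec

/-- The level-`n` force is bounded. [folklore] -/
theorem exists_bound_levelForce (Φ : ShortRangePotential d) {ε : ℝ} (hε : 0 < ε) (n : ℕ) :
    ∃ M : ℝ, ∀ x, ‖levelForce (N := N) Φ ε n x‖ ≤ M := by
  obtain ⟨C, hC⟩ := Φ.exists_bound_gradient_regPot (delta_pos Φ n) (delta_le_one Φ n) hε
  exact ⟨_, norm_pairForce_le hC⟩

/-- The **regularised flow of level `n`** on `(ℝ^d)^N × (ℝ^d)^N` (global: the field is globally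
Lipschitz). [folklore] -/
def levelFlow (Φ : ShortRangePotential d) {ε : ℝ} (hε : 0 < ε) (n : ℕ) (t : ℝ) :
    (Fin N → EuclideanSpace ℝ d) × (Fin N → EuclideanSpace ℝ d) →
      (Fin N → EuclideanSpace ℝ d) × (Fin N → EuclideanSpace ℝ d) :=
  NewtonSystem.flow (lipschitzWith_levelForce (N := N) Φ hε n) t

/-- **Liouville** for the regularised flows. [cite: Arnold1989, §16 Thm 1] -/
theorem measurePreserving_levelFlow (Φ : ShortRangePotential d) {ε : ℝ} (hε : 0 < ε) (n : ℕ)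
    (t : ℝ) : MeasurePreserving (levelFlow (N := N) Φ hε n t) volume volume := by
  obtain ⟨M, hM⟩ := exists_bound_levelForce (N := N) Φ hε n
  exact NewtonSystem.measurePreserving_flow _ hM t

/-- The regularised flow maps are continuous. [folklore] -/
theorem continuous_levelFlow (Φ : ShortRangePotential d) {ε : ℝ} (hε : 0 < ε) (n : ℕ) (t : ℝ) :
    Continuous (levelFlow (N := N) Φ hε n t) :=
  NewtonSystem.continuous_flow _ t

/-! ### Energies and the dynamics of one level -/

/-- The true pair energy `H(x, v) = ½∑|v_i|² + ½∑_i∑_{j≠i} φ(|x_i - x_j|/ε)` on `(ℝ^d)^N × (ℝ^d)^N`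
(finite off coincidences; the symmetric form of `hamiltonianEnergy`). [folklore] -/
def trueEnergy (Φ : ShortRangePotential d) (ε : ℝ)
    (w : (Fin N → EuclideanSpace ℝ d) × (Fin N → EuclideanSpace ℝ d)) : ℝ :=
  pairEnergy (fun y => Φ.φ (‖y‖ / ε)) w

/-- The regularised pair energy of level `n`. [folklore] -/
def levelEnergy (Φ : ShortRangePotential d) (ε : ℝ) (n : ℕ)
    (w : (Fin N → EuclideanSpace ℝ d) × (Fin N → EuclideanSpace ℝ d)) : ℝ :=
  pairEnergy (Φ.regPot (delta Φ n) ε) w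

/-- **Conservation of the regularised energy** along the regularised flow. [folklore] -/
theorem levelEnergy_levelFlow (Φ : ShortRangePotential d) {ε : ℝ} (hε : 0 < ε) (n : ℕ) (t : ℝ)
    (w : (Fin N → EuclideanSpace ℝ d) × (Fin N → EuclideanSpace ℝ d)) :
    levelEnergy Φ ε n (levelFlow Φ hε n t w) = levelEnergy Φ ε n w := by
  have hd : ∀ s, HasDerivAt (fun s => levelEnergy Φ ε n (levelFlow Φ hε n s w)) 0 s := fun s =>
    hasDerivAt_pairEnergy
      (fun hc => Φ.hasDerivAt_regPot_comp (delta_pos Φ n) hε hc)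
      (Φ.gradient_regPot_neg (delta_pos Φ n) hε)
      (NewtonSystem.hasDerivAt_flow _ w s)
  have h := is_const_of_deriv_eq_zero (fun s => (hd s).differentiableAt) (fun s => (hd s).deriv) t 0
  simpa [levelFlow] using h

/-- **Static confinement**: below the energy `φ(δ_n)` all separations exceed `εδ_n`. [folklore] -/
theorem sep_of_levelEnergy_lt (Φ : ShortRangePotential d) {ε : ℝ} (hε : 0 < ε) (n : ℕ)
    {w : (Fin N → EuclideanSpace ℝ d) × (Fin N → EuclideanSpace ℝ d)}
    (hw : levelEnergy Φ ε n w < Φ.φ (delta Φ n)) {i j : Fin N} (hij : i ≠ j) :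
    ε * delta Φ n < ‖w.1 i - w.1 j‖ := by
  by_contra h
  have h1 := Φ.le_regPot (delta_pos Φ n) hε (not_lt.1 h)
  have h2 := apply_le_pairEnergy (Φ.regPot_nonneg (delta Φ n) ε) (Φ.regPot_neg (delta Φ n) ε) w hij
  exact absurd (h1.trans h2) (not_le.2 hw)

/-- If all separations exceed `εδ_n`, the regularised energy is the true energy. [folklore] -/
theorem levelEnergy_eq_trueEnergy (Φ : ShortRangePotential d) {ε : ℝ} (hε : 0 < ε) (n : ℕ)
    {w : (Fin N → EuclideanSpace ℝ d) × (Fin N → EuclideanSpace ℝ d)}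
    (hw : ∀ i j, i ≠ j → ε * delta Φ n < ‖w.1 i - w.1 j‖) :
    levelEnergy Φ ε n w = trueEnergy Φ ε w :=
  pairEnergy_congr fun i j hij => Φ.regPot_eq_of_le (delta_pos Φ n) hε (hw i j hij).le

/-- Off coincidences, a true energy below `φ(δ_n)` forces all separations above `εδ_n` (the
potential is nonincreasing). [folklore] -/
theorem sep_of_trueEnergy_lt (Φ : ShortRangePotential d) {ε : ℝ} (hε : 0 < ε) (n : ℕ)
    {w : (Fin N → EuclideanSpace ℝ d) × (Fin N → EuclideanSpace ℝ d)}
    (hnc : ∀ i j, i ≠ j → w.1 i - w.1 j ≠ 0) (hw : trueEnergy Φ ε w < Φ.φ (delta Φ n))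
    {i j : Fin N} (hij : i ≠ j) : ε * delta Φ n < ‖w.1 i - w.1 j‖ := by
  by_contra h
  have hpos : 0 < ‖w.1 i - w.1 j‖ := norm_pos_iff.2 (hnc i j hij)
  have hr : 0 < ‖w.1 i - w.1 j‖ / ε := div_pos hpos hε
  have hle : ‖w.1 i - w.1 j‖ / ε ≤ delta Φ n := (div_le_iff₀' hε).2 (not_lt.1 h)
  have h1 : Φ.φ (delta Φ n) ≤ Φ.φ (‖w.1 i - w.1 j‖ / ε) := Φ.antitoneOn hr (delta_pos Φ n) hle
  have h2 := apply_le_pairEnergy (P := fun y => Φ.φ (‖y‖ / ε)) (fun y => Φ.nonneg _)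
    (fun y => by simp [norm_neg]) w hij
  exact absurd (h1.trans h2) (not_le.2 hw)

/-- **Dynamics of one level**: starting off coincidences with true energy `< n + 1`, the
level-`n` regularised orbit keeps all separations `> εδ_n` and conserves the true energy.
[folklore] -/
theorem level_dynamics (Φ : ShortRangePotential d) {ε : ℝ} (hε : 0 < ε) (n : ℕ)
    {w : (Fin N → EuclideanSpace ℝ d) × (Fin N → EuclideanSpace ℝ d)}
    (hnc : ∀ i j, i ≠ j → w.1 i - w.1 j ≠ 0) (hw : trueEnergy Φ ε w < n + 1) (t : ℝ) :
    (∀ i j, i ≠ j → ε * delta Φ n < ‖(levelFlow Φ hε n t w).1 i - (levelFlow Φ hε n t w).1 j‖) ∧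
      trueEnergy Φ ε (levelFlow Φ hε n t w) = trueEnergy Φ ε w := by
  have hwφ : trueEnergy Φ ε w < Φ.φ (delta Φ n) := hw.trans (lt_phi_delta Φ n)
  have hsep0 : ∀ i j, i ≠ j → ε * delta Φ n < ‖w.1 i - w.1 j‖ := fun i j hij =>
    sep_of_trueEnergy_lt Φ hε n hnc hwφ hij
  have hE0 : levelEnergy Φ ε n w = trueEnergy Φ ε w := levelEnergy_eq_trueEnergy Φ hε n hsep0
  have hEt : levelEnergy Φ ε n (levelFlow Φ hε n t w) < Φ.φ (delta Φ n) := by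
    rw [levelEnergy_levelFlow, hE0]; exact hwφ
  have hsept : ∀ i j, i ≠ j →
      ε * delta Φ n < ‖(levelFlow Φ hε n t w).1 i - (levelFlow Φ hε n t w).1 j‖ :=
    fun i j hij => sep_of_levelEnergy_lt Φ hε n hEt hij
  refine ⟨hsept, ?_⟩
  rw [← levelEnergy_eq_trueEnergy Φ hε n hsept, levelEnergy_levelFlow, hE0]

/-- **Force agreement**: where all separations exceed `εδ_n`, the regularised force is the true
force `-∑_{j≠i} ∇Φ_ε(x_i - x_j)`. [folklore] -/
theorem levelForce_eq_force (Φ : ShortRangePotential d) {ε : ℝ} (hε : 0 < ε) (n : ℕ)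
    (z : FluidPDE.Config N d (EuclideanSpace ℝ d))
    (hz : ∀ i j, i ≠ j → ε * delta Φ n < ‖(z i).1 - (z j).1‖) (i : Fin N) :
    levelForce Φ ε n (fun k => (z k).1) i = force (FluidPDE.Euclidean.geometry d) Φ ε z i := by
  change -∑ j ∈ Finset.univ.erase i, gradient (Φ.regPot (delta Φ n) ε) ((z i).1 - (z j).1) =
    -∑ j ∈ Finset.univ.erase i, gradient (Φ.scaled ε) ((z i).1 - (z j).1)
  congr 1
  refine Finset.sum_congr rfl fun j hj => ?_
  exact Φ.gradient_regPot_eq (delta_pos Φ n) hε (hz i j (Finset.ne_of_mem_erase hj).symm)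

/-! ### The flow on the configuration space `Config N d ℝ^d` -/

/-- The (measure-preserving) identification `Config N d ℝ^d ≃ (ℝ^d)^N × (ℝ^d)^N`,
`z ↦ ((x_i)_i, (v_i)_i)`. [folklore] -/
def cfgEquiv (N : ℕ) (d : Type*) [Fintype d] :
    FluidPDE.Config N d (EuclideanSpace ℝ d) ≃ᵐ
      (Fin N → EuclideanSpace ℝ d) × (Fin N → EuclideanSpace ℝ d) :=
  MeasurableEquiv.arrowProdEquivProdArrow (EuclideanSpace ℝ d) (EuclideanSpace ℝ d) (Fin N)

/-- `cfgEquiv` preserves Lebesgue measure. [folklore] -/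
theorem measurePreserving_cfgEquiv (N : ℕ) (d : Type*) [Fintype d] :
    MeasurePreserving (cfgEquiv N d) volume volume :=
  volume_measurePreserving_arrowProdEquivProdArrow _ _ _

/-- The true energy of a configuration (the level selector). [folklore] -/
def cfgEnergy (Φ : ShortRangePotential d) (ε : ℝ) (z : FluidPDE.Config N d (EuclideanSpace ℝ d)) : ℝ :=
  trueEnergy Φ ε (cfgEquiv N d z)

/-- The level of a configuration: `⌊H(z)⌋₊`. [folklore] -/
def level (Φ : ShortRangePotential d) (ε : ℝ) (z : FluidPDE.Config N d (EuclideanSpace ℝ d)) : ℕ :=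
  ⌊cfgEnergy Φ ε z⌋₊

/-- The level-`n` flow transported to configurations. [folklore] -/
def levelMap (Φ : ShortRangePotential d) {ε : ℝ} (hε : 0 < ε) (n : ℕ) (t : ℝ)
    (z : FluidPDE.Config N d (EuclideanSpace ℝ d)) : FluidPDE.Config N d (EuclideanSpace ℝ d) :=
  (cfgEquiv N d).symm (levelFlow Φ hε n t (cfgEquiv N d z))

/-- **The flow**: a configuration of level `n` is moved by the level-`n` regularised flow (which,
for non-coincident data, is the true Hamiltonian flow: `level_dynamics`, `levelForce_eq_force`).
[folklore] -/
def flowMap (Φ : ShortRangePotential d) {ε : ℝ} (hε : 0 < ε) (t : ℝ)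
    (z : FluidPDE.Config N d (EuclideanSpace ℝ d)) : FluidPDE.Config N d (EuclideanSpace ℝ d) :=
  levelMap Φ hε (level Φ ε z) t z

/-- `y ↦ φ(|y|/ε)` is measurable (continuous off the origin). [folklore] -/
theorem measurable_phi_norm_div (Φ : ShortRangePotential d) {ε : ℝ} (hε : 0 < ε) :
    Measurable fun y : EuclideanSpace ℝ d => Φ.φ (‖y‖ / ε) := by
  refine measurable_of_continuousOn_compl_singleton (0 : EuclideanSpace ℝ d) ?_
  have h1 : ContinuousOn (fun y : EuclideanSpace ℝ d => ‖y‖ / ε) {0}ᶜ :=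
    (continuous_norm.div_const ε).continuousOn
  refine Φ.contDiffOn.continuousOn.comp h1 fun y hy => ?_
  exact div_pos (norm_pos_iff.2 hy) hε

/-- The level selector is measurable. [folklore] -/
theorem measurable_cfgEnergy (Φ : ShortRangePotential d) {ε : ℝ} (hε : 0 < ε) :
    Measurable (cfgEnergy (N := N) Φ ε) := by
  unfold cfgEnergy trueEnergy pairEnergy
  refine Measurable.add (Measurable.const_mul (Finset.measurable_sum _ fun i _ => ?_) _)
    (Measurable.const_mul (Finset.measurable_sum _ fun i _ =>
      Finset.measurable_sum _ fun j _ => ?_) _)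
  · exact ((measurable_pi_apply i).snd).norm.pow_const 2
  · exact (measurable_phi_norm_div Φ hε).comp
      ((measurable_pi_apply i).fst.sub (measurable_pi_apply j).fst)

/-- The level is measurable. [folklore] -/
theorem measurable_level (Φ : ShortRangePotential d) {ε : ℝ} (hε : 0 < ε) :
    Measurable (level (N := N) Φ ε) :=
  (measurable_cfgEnergy Φ hε).nat_floor

/-- The transported level maps are measurable. [folklore] -/
theorem measurable_levelMap (Φ : ShortRangePotential d) {ε : ℝ} (hε : 0 < ε) (n : ℕ) (t : ℝ) :
    Measurable (levelMap (N := N) Φ hε n t) :=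
  (cfgEquiv N d).symm.measurable.comp
    ((continuous_levelFlow Φ hε n t).measurable.comp (cfgEquiv N d).measurable)

/-- The transported level maps preserve Lebesgue measure. [folklore] -/
theorem measurePreserving_levelMap (Φ : ShortRangePotential d) {ε : ℝ} (hε : 0 < ε) (n : ℕ)
    (t : ℝ) : MeasurePreserving (levelMap (N := N) Φ hε n t) volume volume :=
  (measurePreserving_cfgEquiv N d).symm.comp
    ((measurePreserving_levelFlow Φ hε n t).comp (measurePreserving_cfgEquiv N d))

/-- Group law of the transported level maps. [folklore] -/
theorem levelMap_add (Φ : ShortRangePotential d) {ε : ℝ} (hε : 0 < ε) (n : ℕ) (s t : ℝ)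
    (z : FluidPDE.Config N d (EuclideanSpace ℝ d)) :
    levelMap Φ hε n (s + t) z = levelMap Φ hε n t (levelMap Φ hε n s z) := by
  simp only [levelMap, MeasurableEquiv.apply_symm_apply]
  rw [levelFlow, NewtonSystem.flow_add]
  rfl

/-- `levelMap n 0 = id`. [folklore] -/
theorem levelMap_zero (Φ : ShortRangePotential d) {ε : ℝ} (hε : 0 < ε) (n : ℕ)
    (z : FluidPDE.Config N d (EuclideanSpace ℝ d)) : levelMap Φ hε n 0 z = z := by
  simp only [levelMap, levelFlow, NewtonSystem.flow_zero, MeasurableEquiv.symm_apply_apply]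

/-- `levelMap n (-t)` inverts `levelMap n t`. [folklore] -/
theorem levelMap_neg_levelMap (Φ : ShortRangePotential d) {ε : ℝ} (hε : 0 < ε) (n : ℕ) (t : ℝ)
    (z : FluidPDE.Config N d (EuclideanSpace ℝ d)) :
    levelMap Φ hε n (-t) (levelMap Φ hε n t z) = z := by
  rw [← levelMap_add, add_neg_cancel, levelMap_zero]

/-- The flow maps are measurable (countably many measurable pieces). [folklore] -/
theorem measurable_flowMap (Φ : ShortRangePotential d) {ε : ℝ} (hε : 0 < ε) (t : ℝ) :
    Measurable (flowMap (N := N) Φ hε t) := by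
  have h : flowMap (N := N) Φ hε t =
      (fun p : FluidPDE.Config N d (EuclideanSpace ℝ d) × ℕ => levelMap Φ hε p.2 t p.1) ∘
        fun z => (z, level Φ ε z) := rfl
  rw [h]
  exact (measurable_from_prod_countable_left fun n => measurable_levelMap Φ hε n t).comp
    (measurable_id.prodMk (measurable_level Φ hε))

end PotentialFlow.NonemptyEuclidean


namespace PotentialFlow.NonemptyEuclidean

variable {d : Type*} [Fintype d] {N : ℕ}

/-! ### The good set: non-coincident configurations -/

/-- The coincidence hyperplane `{x_i = x_j}` of `(ℝ^d)^N × (ℝ^d)^N`, as a submodule. [folklore] -/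
def coincidencePlane (i j : Fin N) :
    Submodule ℝ ((Fin N → EuclideanSpace ℝ d) × (Fin N → EuclideanSpace ℝ d)) where
  carrier := {w | w.1 i - w.1 j = 0}
  add_mem' := by
    intro a b ha hb
    simp only [mem_setOf_eq, Prod.fst_add, Pi.add_apply] at *
    rw [add_sub_add_comm, ha, hb, add_zero]
  zero_mem' := by simp
  smul_mem' := by
    intro c w hw
    simp only [mem_setOf_eq, Prod.smul_fst, Pi.smul_apply] at *
    rw [← smul_sub, hw, smul_zero]

omit [Fintype d] in
/-- Membership in the coincidence hyperplane. [folklore] -/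
theorem mem_coincidencePlane {i j : Fin N}
    {w : (Fin N → EuclideanSpace ℝ d) × (Fin N → EuclideanSpace ℝ d)} :
    w ∈ coincidencePlane i j ↔ w.1 i - w.1 j = 0 :=
  Iff.rfl

omit [Fintype d] in
/-- For `i ≠ j` (and `d ≠ ∅`) the coincidence hyperplane is a proper subspace. [folklore] -/
theorem coincidencePlane_ne_top [Nonempty d] {i j : Fin N} (hij : i ≠ j) :
    coincidencePlane (d := d) i j ≠ ⊤ := by
  classical
  obtain ⟨k⟩ := ‹Nonempty d›
  set y₀ : EuclideanSpace ℝ d := EuclideanSpace.single k (1 : ℝ) with hy₀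
  have hy : y₀ ≠ 0 := by
    intro h
    have h1 : y₀ k = 1 := by simp [hy₀]
    rw [h] at h1
    simp at h1
  intro htop
  have hmem : ((Pi.single i y₀ : Fin N → EuclideanSpace ℝ d), (0 : Fin N → EuclideanSpace ℝ d)) ∈
      coincidencePlane (d := d) i j := by rw [htop]; exact Submodule.mem_top
  rw [mem_coincidencePlane] at hmem
  simp [hij.symm] at hmem
  exact hy hmem

/-- Coincidence hyperplanes are Lebesgue-null. [folklore] -/
theorem volume_coincidencePlane [Nonempty d] {i j : Fin N} (hij : i ≠ j) :
    volume (coincidencePlane (d := d) i j :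
      Set ((Fin N → EuclideanSpace ℝ d) × (Fin N → EuclideanSpace ℝ d))) = 0 := by
  haveI : (volume : Measure ((Fin N → EuclideanSpace ℝ d) ×
      (Fin N → EuclideanSpace ℝ d))).IsAddHaarMeasure :=
    Measure.prod.instIsAddHaarMeasure _ _
  exact Measure.addHaar_submodule volume _ (coincidencePlane_ne_top hij)

/-- The non-coincidence set of `ℝ^d` configurations is measurable. [folklore] -/
theorem measurableSet_noCoincidence :
    MeasurableSet (noCoincidence (FluidPDE.Euclidean.geometry d) N :
      Set (FluidPDE.Config N d (EuclideanSpace ℝ d))) := by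
  have h : (noCoincidence (FluidPDE.Euclidean.geometry d) N :
      Set (FluidPDE.Config N d (EuclideanSpace ℝ d))) =
      ⋂ i, ⋂ j, {z | i ≠ j → (z i).1 - (z j).1 ≠ 0} := by
    ext z
    simp only [mem_noCoincidence, FluidPDE.Euclidean.geometry_sepVec, mem_iInter, mem_setOf_eq]
  rw [h]
  refine MeasurableSet.iInter fun i => MeasurableSet.iInter fun j => ?_
  by_cases hij : i = j
  · simp [hij]
  · simp only [ne_eq, hij, not_false_eq_true, forall_const]
    exact ((measurable_pi_apply i).fst.sub (measurable_pi_apply j).fst)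
      (measurableSet_singleton (0 : EuclideanSpace ℝ d)).compl

/-- **The coincidence set is Lebesgue-null** (a finite union of proper hyperplanes; needs
`d ≠ ∅`). [folklore] -/
theorem volume_compl_noCoincidence [Nonempty d] :
    volume (noCoincidence (FluidPDE.Euclidean.geometry d) N :
      Set (FluidPDE.Config N d (EuclideanSpace ℝ d)))ᶜ = 0 := by
  have hsub : (noCoincidence (FluidPDE.Euclidean.geometry d) N :
      Set (FluidPDE.Config N d (EuclideanSpace ℝ d)))ᶜ ⊆
      ⋃ i : Fin N, ⋃ j : Fin N,
        {z | i ≠ j ∧ cfgEquiv N d z ∈ coincidencePlane (d := d) i j} := by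
    intro z hz
    rw [mem_compl_iff, mem_noCoincidence] at hz
    push Not at hz
    obtain ⟨i, j, hij, h0⟩ := hz
    refine mem_iUnion.2 ⟨i, mem_iUnion.2 ⟨j, hij, ?_⟩⟩
    rw [mem_coincidencePlane]
    exact h0
  refine measure_mono_null hsub (measure_iUnion_null fun i => measure_iUnion_null fun j => ?_)
  by_cases hij : i = j
  · simp [hij]
  · have e : {z : FluidPDE.Config N d (EuclideanSpace ℝ d) |
        i ≠ j ∧ cfgEquiv N d z ∈ coincidencePlane (d := d) i j} =
        cfgEquiv N d ⁻¹' (coincidencePlane (d := d) i j :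
          Set ((Fin N → EuclideanSpace ℝ d) × (Fin N → EuclideanSpace ℝ d))) := by
      ext z; simp [hij]
    rw [e, (measurePreserving_cfgEquiv N d).measure_preimage
      (coincidencePlane (d := d) i j).closed_of_finiteDimensional.measurableSet.nullMeasurableSet]
    exact volume_coincidencePlane hij

/-! ### The good-set dynamics of the flow -/

section Good

variable (Φ : ShortRangePotential d) {ε : ℝ} (hε : 0 < ε)

/-- Non-coincidence in terms of `cfgEquiv`. [folklore] -/
theorem nc_of_mem_noCoincidence {z : FluidPDE.Config N d (EuclideanSpace ℝ d)}
    (hz : z ∈ noCoincidence (FluidPDE.Euclidean.geometry d) N) :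
    ∀ i j, i ≠ j → (cfgEquiv N d z).1 i - (cfgEquiv N d z).1 j ≠ 0 := fun i j hij =>
  (mem_noCoincidence.1 hz) i j hij

/-- A configuration's energy lies below the next integer above its level. [folklore] -/
theorem cfgEnergy_lt_level_add_one (ε : ℝ) (z : FluidPDE.Config N d (EuclideanSpace ℝ d)) :
    trueEnergy Φ ε (cfgEquiv N d z) < (level Φ ε z : ℝ) + 1 :=
  Nat.lt_floor_add_one _

/-- **Good-set dynamics**: for a non-coincident `z` of level `n`, at every time the transported
level-`n` orbit has all separations `> εδ_n`, stays non-coincident and keeps its level. [folklore] -/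
theorem good_dynamics {z : FluidPDE.Config N d (EuclideanSpace ℝ d)}
    (hz : z ∈ noCoincidence (FluidPDE.Euclidean.geometry d) N) (t : ℝ) :
    (∀ i j, i ≠ j → ε * delta Φ (level Φ ε z) <
        ‖(levelMap Φ hε (level Φ ε z) t z i).1 - (levelMap Φ hε (level Φ ε z) t z j).1‖) ∧
      levelMap Φ hε (level Φ ε z) t z ∈ noCoincidence (FluidPDE.Euclidean.geometry d) N ∧
      level Φ ε (levelMap Φ hε (level Φ ε z) t z) = level Φ ε z := by
  have h := level_dynamics Φ hε (level Φ ε z) (nc_of_mem_noCoincidence hz)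
    (cfgEnergy_lt_level_add_one Φ ε z) t
  have hsep : ∀ i j, i ≠ j → ε * delta Φ (level Φ ε z) <
      ‖(levelMap Φ hε (level Φ ε z) t z i).1 - (levelMap Φ hε (level Φ ε z) t z j).1‖ :=
    fun i j hij => h.1 i j hij
  refine ⟨hsep, ?_, ?_⟩
  · rw [mem_noCoincidence]
    intro i j hij h0
    have h1 := hsep i j hij
    have h0' : (levelMap Φ hε (level Φ ε z) t z i).1 - (levelMap Φ hε (level Φ ε z) t z j).1 = 0 :=
      h0
    rw [h0', norm_zero] at h1
    exact absurd h1 (not_lt.2 (mul_pos hε (delta_pos Φ _)).le)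
  · unfold level cfgEnergy
    congr 1
    simp only [levelMap, MeasurableEquiv.apply_symm_apply]
    exact h.2

/-- The good set is invariant. [folklore] -/
theorem flowMap_mem_noCoincidence {z : FluidPDE.Config N d (EuclideanSpace ℝ d)}
    (hz : z ∈ noCoincidence (FluidPDE.Euclidean.geometry d) N) (t : ℝ) :
    flowMap Φ hε t z ∈ noCoincidence (FluidPDE.Euclidean.geometry d) N :=
  (good_dynamics Φ hε hz t).2.1

/-- The level is conserved along the flow on the good set. [folklore] -/
theorem level_flowMap {z : FluidPDE.Config N d (EuclideanSpace ℝ d)}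
    (hz : z ∈ noCoincidence (FluidPDE.Euclidean.geometry d) N) (t : ℝ) :
    level Φ ε (flowMap Φ hε t z) = level Φ ε z :=
  (good_dynamics Φ hε hz t).2.2

/-- `Ψ_0 = id` (everywhere). [folklore] -/
theorem flowMap_zero (z : FluidPDE.Config N d (EuclideanSpace ℝ d)) : flowMap Φ hε 0 z = z :=
  levelMap_zero Φ hε _ z

/-- The group property on the good set. [folklore] -/
theorem flowMap_add {z : FluidPDE.Config N d (EuclideanSpace ℝ d)}
    (hz : z ∈ noCoincidence (FluidPDE.Euclidean.geometry d) N) (s t : ℝ) :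
    flowMap Φ hε (s + t) z = flowMap Φ hε s (flowMap Φ hε t z) := by
  have hl := level_flowMap Φ hε hz t
  unfold flowMap at hl ⊢
  rw [hl, add_comm, levelMap_add]

/-- Orbits of good points are Hamiltonian trajectories of the true system. [folklore] -/
theorem isHamiltonianTrajectory_flowMap {z : FluidPDE.Config N d (EuclideanSpace ℝ d)}
    (hz : z ∈ noCoincidence (FluidPDE.Euclidean.geometry d) N) :
    IsHamiltonianTrajectory (FluidPDE.Euclidean.geometry d) Φ ε N fun t => flowMap Φ hε t z := by
  set n := level Φ ε z with hn
  set w := cfgEquiv N d z with hw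
  have hK := lipschitzWith_levelForce (N := N) Φ hε n
  have hvel : ∀ t i, (flowMap Φ hε t z).vel i = (levelFlow Φ hε n t w).2 i := fun t i => rfl
  have hpos : ∀ t i, (flowMap Φ hε t z).pos i = (levelFlow Φ hε n t w).1 i := fun t i => rfl
  refine ⟨fun t i => ?_, fun t i => ?_⟩
  · -- Newton's law
    have h1 : HasDerivAt (fun s => (levelFlow Φ hε n s w).2 i)
        (levelForce Φ ε n (levelFlow Φ hε n t w).1 i) t :=
      (hasDerivAt_pi.1 (NewtonSystem.hasDerivAt_snd hK w t)) i
    have h2 : levelForce Φ ε n (levelFlow Φ hε n t w).1 i =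
        force (FluidPDE.Euclidean.geometry d) Φ ε (flowMap Φ hε t z) i :=
      levelForce_eq_force Φ hε n (flowMap Φ hε t z) (good_dynamics Φ hε hz t).1 i
    simp_rw [hvel]
    rw [← h2]
    exact h1
  · -- positions are the integrated velocities
    simp_rw [hpos, hvel]
    rw [FluidPDE.Euclidean.geometry_translate]
    have hd : ∀ s, HasDerivAt (fun s => (levelFlow Φ hε n s w).1 i)
        ((levelFlow Φ hε n s w).2 i) s :=
      fun s => (hasDerivAt_pi.1 (NewtonSystem.hasDerivAt_fst hK w s)) i
    have hcont : Continuous fun s => (levelFlow Φ hε n s w).2 i :=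
      continuous_iff_continuousAt.2 fun s =>
        ((hasDerivAt_pi.1 (NewtonSystem.hasDerivAt_snd hK w s)) i).continuousAt
    rw [intervalIntegral.integral_eq_sub_of_hasDerivAt (fun s _ => hd s)
      (hcont.intervalIntegrable _ _)]
    simp [levelFlow]

end Good

/-! ### Liouville for the glued flow -/

/-- The glued flow preserves Lebesgue measure: on each invariant piece
`G_n = good ∩ {level = n}` it is the measure-preserving `levelMap n t`, and the pieces partition a
conull set. [cite: Arnold1989, §16 Thm 1] -/
theorem measurePreserving_flowMap [Nonempty d] (Φ : ShortRangePotential d) {ε : ℝ} (hε : 0 < ε)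
    (t : ℝ) : MeasurePreserving (flowMap (N := N) Φ hε t) volume volume := by
  set good : Set (FluidPDE.Config N d (EuclideanSpace ℝ d)) :=
    noCoincidence (FluidPDE.Euclidean.geometry d) N with hgood_def
  set G : ℕ → Set (FluidPDE.Config N d (EuclideanSpace ℝ d)) :=
    fun n => good ∩ {z | level Φ ε z = n} with hG
  have hgoodm : MeasurableSet good := measurableSet_noCoincidence
  have hGm : ∀ n, MeasurableSet (G n) := fun n =>
    hgoodm.inter (measurable_level Φ hε (measurableSet_singleton n))
  have hGdisj : Pairwise (Function.onFun Disjoint G) := by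
    intro m n hmn
    refine disjoint_left.2 fun z hzm hzn => hmn ?_
    exact hzm.2.symm.trans hzn.2
  have hGU : (⋃ n, G n) = good := by
    ext z
    simp only [mem_iUnion, hG, mem_inter_iff, mem_setOf_eq]
    exact ⟨fun ⟨n, h, _⟩ => h, fun h => ⟨_, h, rfl⟩⟩
  have hae : ∀ᵐ z ∂(volume : Measure (FluidPDE.Config N d (EuclideanSpace ℝ d))), z ∈ good := by
    rw [ae_iff]
    exact volume_compl_noCoincidence
  -- invariance of the pieces under the level maps
  have hmaps : ∀ n s, MapsTo (levelMap Φ hε n s) (G n) (G n) := by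
    rintro n s z ⟨hz, hzn⟩
    have hzn' : level Φ ε z = n := hzn
    have h := good_dynamics Φ hε hz s
    rw [hzn'] at h
    exact ⟨h.2.1, h.2.2⟩
  have hpre : ∀ n, levelMap Φ hε n t ⁻¹' (G n) = G n := by
    intro n
    refine Subset.antisymm (fun z hz => ?_) (fun z hz => hmaps n t hz)
    have h := hmaps n (-t) hz
    rwa [levelMap_neg_levelMap] at h
  have hmeas := measurable_flowMap (N := N) Φ hε t
  -- on each piece the glued flow is the level map, which preserves the restricted measure
  have hrestr : ∀ n, (volume.restrict (G n)).map (flowMap Φ hε t) = volume.restrict (G n) := by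
    intro n
    have hcongr : (volume.restrict (G n)).map (flowMap Φ hε t) =
        (volume.restrict (G n)).map (levelMap Φ hε n t) := by
      refine Measure.map_congr ?_
      filter_upwards [ae_restrict_mem (hGm n)] with z hz
      show levelMap Φ hε (level Φ ε z) t z = levelMap Φ hε n t z
      rw [show level Φ ε z = n from hz.2]
    rw [hcongr]
    ext B hB
    rw [Measure.map_apply (measurable_levelMap Φ hε n t) hB, Measure.restrict_apply hB,
      Measure.restrict_apply (hB.preimage (measurable_levelMap Φ hε n t))]
    calc volume (levelMap Φ hε n t ⁻¹' B ∩ G n)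
        = volume (levelMap Φ hε n t ⁻¹' (B ∩ G n)) := by rw [preimage_inter, hpre]
      _ = volume (B ∩ G n) :=
          (measurePreserving_levelMap Φ hε n t).measure_preimage
            (hB.inter (hGm n)).nullMeasurableSet
  -- assemble
  have hvol : (volume : Measure (FluidPDE.Config N d (EuclideanSpace ℝ d))) =
      Measure.sum fun n => volume.restrict (G n) := by
    rw [← Measure.restrict_iUnion hGdisj hGm, hGU, Measure.restrict_eq_self_of_ae_mem hae]
  refine ⟨hmeas, ?_⟩
  conv_lhs => rw [hvol]
  rw [Measure.map_sum hmeas.aemeasurable]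
  conv_rhs => rw [hvol]
  congr 1
  funext n
  exact hrestr n

/-! ### The structure and the discharge -/

/-- **The Hamiltonian flow of `N` particles in `ℝ^d` interacting through `Φ_ε`** as a
`PotentialFlow` (good set = non-coincident configurations `Ω_N`; GST 2012 Ch. 4, the Hamiltonian
flow behind Liouville's equation (4.0.1)). [cite: GallagherSaintraymondTexier2012, v1 Ch. 4 p. 21 (4.0.1) and Ω_N] -/
def potentialFlow [Nonempty d] (Φ : ShortRangePotential d) {ε : ℝ} (hε : 0 < ε) (N : ℕ) :
    PotentialFlow (FluidPDE.Euclidean.geometry d) Φ ε N where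
  flow := flowMap Φ hε
  good := noCoincidence (FluidPDE.Euclidean.geometry d) N
  measurableSet_good := measurableSet_noCoincidence
  good_subset := Subset.rfl
  measure_compl_good := volume_compl_noCoincidence
  mapsTo_good := fun t _ hz => flowMap_mem_noCoincidence Φ hε hz t
  flow_zero := fun z _ => flowMap_zero Φ hε z
  flow_add := fun s t _ hz => flowMap_add Φ hε hz s t
  measurable_flow := measurable_flowMap Φ hε
  isTrajectory := fun _ hz => isHamiltonianTrajectory_flowMap Φ hε hz
  measurePreserving := measurePreserving_flowMap Φ hε

end PotentialFlow.NonemptyEuclidean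

namespace PotentialFlow

variable {d : Type*} [Fintype d]

/-- **Existence of the Hamiltonian flow in `ℝ^d`** — discharge of the named fact
`PotentialFlow.nonempty_euclidean` (GST: the `N`-particle Hamiltonian system (1.2.2), whose flow on
`Ω_N = {Z_N | ∀ i ≠ j, x_i ≠ x_j}` underlies Liouville's equation (4.0.1), Ch. 4; global a.e.
dynamics for potentials is "a simple consequence of the Cauchy-Lipschitz theorem" and energy
conservation, Ch. 2 §2.1 p. 9; volume preservation is Liouville's theorem, Arnold §16 Thm 1). PROOF
(this file): for data of energy `< n + 1` the pair profile is regularised below the floor `δ_n`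
(`φ(δ_n) > n + 1`) into a `C²` pair potential with compactly supported gradient; the regularised
system has a global Lipschitz flow (`Literature.Analysis.ODE.lipschitzFlow`) preserving volume
(`NewtonSystem.measurePreserving_flow`: symplectic-Euler shears + Fatou); conservation of the
regularised energy keeps all separations `> εδ_n`, where the regularised force IS the true force, so
these orbits are true Hamiltonian trajectories and the level `n = ⌊H⌋₊` is invariant; gluing the
levels gives a measurable, measure-preserving group of trajectories on the non-coincidence set, whose
complement (a finite union of proper hyperplanes, `d ≠ ∅`) is null. [cite: GallagherSaintraymondTexier2012, v1 Ch. 1 (1.2.2); Ch. 2 §2.1 p. 9; Ch. 4 p. 21 (4.0.1)] -/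
theorem nonempty_euclidean_holds : nonempty_euclidean (d := d) := by
  intro _ Φ ε hε N
  exact ⟨NonemptyEuclidean.potentialFlow Φ hε N⟩

end PotentialFlow

end Literature.Analysis.FunctionSpaces
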